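import Mathlib
import Literature.Computability.Complexity.CookLevinTableau
import Literature.Computability.Complexity.DigitPolynomials
import Literature.Computability.Complexity.AlgebraicPCP
import HarnessLib

/-!
# The arithmetized Cook–Levin tableau: the clause set of a `TM2` machine as an algebraic CSP over `Hᵐ`

Literature / complexity toolkit, a brick of the probabilistically checkable proofs for
exponential-time computations (Babai–Fortnow–Lund 1991, §4 "arithmetization"; Babai–Fortnow–
Levin–Szegedy 1991, §4; Arora–Barak 2009, §11.5.2 / §8.6). The Cook–Levin clause set
`Tableau.clauses M P T x` of `CookLevinTableau.lean` (Sipser 2012, Thm. 7.37, for Mathlib's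
multi-stack machines) has `Θ(T²)` clauses but only a BOUNDED number of clause SHAPES, each
repeated over all rows `t` and columns `J`. Writing `t` and `J` in base `h` with `k_t`, `k_J` digits
ranging over the node set `H = {0, …, h-1} ⊆ F` (`DigitPoly.nodes h`), one-hot encoding the block
values (`Val M.tm`, finitely many) by one more coordinate, every clause shape becomes ONE constraint
family of an `AlgebraicPCP.CSP` (`AlgebraicPCP.lean`): the family is indexed by the digit vectors
of the rows/columns it mentions, its reads are the tableau entries at addresses that are
coordinates of the index or constants, and its polynomial is
`guard(index) · ∏_{premises} Y · ∏_{conclusions} (1 - Y)`, the guard being the product of the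
range / successor indicators of `DigitPolynomials.lean` (`LTC`, `SUCC`). Main result
(`satisfiable_tableauCSP_iff`): for `|Val| ≤ h`, `T < h^{k_t}`, `S₁ < h^{k_J}` and `ℕ → F`
injective below `h`,

  `(tableauCSP M L P T x).Satisfiable (nodes h) ↔ ∃ τ, ∀ cl ∈ Tableau.clauses M P T x, Holds τ cl`,

whence, with `Tableau.sound`/`Tableau.complete`, `↔ ∃ u, |u| ≤ P ∧ f (boolPair x u) = true` for a
machine halting within `T` steps with output `[f w]` (`satisfiable_tableauCSP_iff_exists`).
Direction `→` decodes a satisfying oracle into the assignment `τOf` (`holds_of_satisfies`: at the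
digit index of a clause the guard is `1` and the reads are the literals of the clause); direction
`←` encodes an assignment as the `0/1` oracle `Y0` (`satisfies_Y0`: at every `H`-index either the
guard vanishes or the index is the digit index of a clause of the set, whose satisfaction kills
the clause product). Also: the CSP is well formed on the node set (`wf_tableauCSP`, for
`|Val| ≤ h`) and its constraint polynomials have total degree `≤ degBound M L =
(3 k_t + (4d+2) k_J)(h-1) + 3d + 3 + |Val|` (`maxDeg_tableauCSP_le`) — the two side conditions of
`AlgebraicPCP.completeness` / `AlgebraicPCP.soundness`.

## References

* L. Babai, L. Fortnow, C. Lund, *Non-deterministic exponential time has two-prover interactive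
  protocols*, Comput. Complexity 1 (1991), §4 [BabaiFortnowLund1991].
* L. Babai, L. Fortnow, L. Levin, M. Szegedy, *Checking computations in polylogarithmic time*,
  STOC 1991, §4 [BFLS1991].
* M. Sipser, *Introduction to the Theory of Computation*, 3rd ed., 2012, Thm. 7.37 [Sipser2012].
* S. Arora, B. Barak, *Computational Complexity: A Modern Approach*, CUP 2009, §11.5.2, §8.6
  [AroraBarakCC2009].
-/

noncomputable section

open Finset Polynomial

namespace Literature.Computability.Complexity

namespace TableauCSP

open Turing Tableau DigitPoly AlgebraicPCP MvPolynomial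

variable {F : Type} [Field F] [DecidableEq F]
variable (M : TM2ComputableAux Bool Bool)

attribute [local instance] Turing.FinTM2.kFin Turing.FinTM2.ΛFin Turing.FinTM2.σFin
  Turing.FinTM2.Γk₀Fin

/-! ### Layout: digits of rows and columns, the value coordinate -/

/-- The layout parameters: base `h`, `kt` digits for rows, `kJ` digits for columns. [folklore] -/
structure Layout where
  /-- the base (size of the node set) -/
  h : ℕ
  /-- digits of a row number -/
  kt : ℕ
  /-- digits of a column number -/
  kJ : ℕ

variable (L : Layout)

/-- Arity of a tableau point: `kt` row digits, `kJ` column digits, one value code. [folklore] -/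
def mPt : ℕ := L.kt + L.kJ + 1

/-- Arity of a constraint index: two rows `t, t'` and `2d + 1` columns. [folklore] -/
def KIdx (d : ℕ) : ℕ := L.kt + L.kt + (2 * d + 1) * L.kJ

/-- The structured view of a point: (row digit | column digit) | value. [folklore] -/
def ptEquiv : (Fin L.kt ⊕ Fin L.kJ) ⊕ Fin 1 ≃ Fin (mPt L) := finSumFinEquiv.sumCongr (Equiv.refl _) |>.trans finSumFinEquiv

/-- The structured view of an index: (digit of `t` | digit of `t'`) | (column, digit). [folklore] -/
def idxEquiv (d : ℕ) : (Fin L.kt ⊕ Fin L.kt) ⊕ (Fin (2 * d + 1) × Fin L.kJ) ≃ Fin (KIdx L d) :=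
  (finSumFinEquiv.sumCongr finProdFinEquiv).trans finSumFinEquiv

variable {L}

/-- The row digits `t` inside an index. [folklore] -/
def tSlot {d : ℕ} (i : Fin L.kt) : Fin (KIdx L d) := idxEquiv L d (Sum.inl (Sum.inl i))

/-- The row digits `t'` inside an index. [folklore] -/
def t'Slot {d : ℕ} (i : Fin L.kt) : Fin (KIdx L d) := idxEquiv L d (Sum.inl (Sum.inr i))

/-- The digits of the `c`-th column inside an index. [folklore] -/
def cSlot {d : ℕ} (c : Fin (2 * d + 1)) (i : Fin L.kJ) : Fin (KIdx L d) := idxEquiv L d (Sum.inr (c, i))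

/-- The value code of a block value (an injection into `ℕ`, below `|Val|`). [folklore] -/
def vcode (v : Val M.tm) : ℕ := haveI := Fintype.ofFinite (Val M.tm); (Fintype.equivFin (Val M.tm) v : ℕ)

/-- Value codes are small. [folklore] -/
theorem vcode_lt (v : Val M.tm) : vcode M v < Nat.card (Val M.tm) := by
  letI := Fintype.ofFinite (Val M.tm)
  rw [Nat.card_eq_fintype_card]
  exact (Fintype.equivFin (Val M.tm) v).2

/-- Value codes are injective. [folklore] -/
theorem vcode_injective : Function.Injective (vcode M) := by
  intro v v' hv
  letI := Fintype.ofFinite (Val M.tm)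
  exact (Fintype.equivFin (Val M.tm)).injective (Fin.ext hv)

/-- **A tableau point** from row digits, column digits and a value code. [folklore] -/
def mkPt (nt : Fin L.kt → F) (nJ : Fin L.kJ → F) (c : F) : Fin (mPt L) → F := fun u =>
  match (ptEquiv L).symm u with
  | Sum.inl (Sum.inl i) => nt i
  | Sum.inl (Sum.inr i) => nJ i
  | Sum.inr _ => c

/-- **An address of a tableau point**: row digits, column digits (each a coordinate of the index
or a constant) and a constant value code. [cite: BabaiFortnowLund1991, §4] -/
def mkAddr {K : ℕ} (ts : Fin L.kt → Fin K ⊕ F) (js : Fin L.kJ → Fin K ⊕ F) (c : F) : Fin (mPt L) → Fin K ⊕ F :=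
  fun u =>
    match (ptEquiv L).symm u with
    | Sum.inl (Sum.inl i) => ts i
    | Sum.inl (Sum.inr i) => js i
    | Sum.inr _ => Sum.inr c

omit [Field F] [DecidableEq F] in
/-- Reading an address gives the point assembled from the read digit sources. [folklore] -/
theorem readAddr_mkAddr {K : ℕ} (ts : Fin L.kt → Fin K ⊕ F) (js : Fin L.kJ → Fin K ⊕ F) (c : F) (z : Fin K → F) :
    readAddr (mkAddr ts js c) z = mkPt (fun i => Sum.elim z id (ts i)) (fun i => Sum.elim z id (js i)) c := by
  funext u
  unfold readAddr mkAddr mkPt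
  rcases (ptEquiv L).symm u with (i | i) | i <;> rfl

omit [Field F] [DecidableEq F] in
/-- Row digit `i` of a point. [folklore] -/
@[simp] theorem mkPt_row (nt : Fin L.kt → F) (nJ : Fin L.kJ → F) (c : F) (i : Fin L.kt) :
    mkPt nt nJ c (ptEquiv L (Sum.inl (Sum.inl i))) = nt i := by
  simp [mkPt]

omit [Field F] [DecidableEq F] in
/-- Column digit `i` of a point. [folklore] -/
@[simp] theorem mkPt_col (nt : Fin L.kt → F) (nJ : Fin L.kJ → F) (c : F) (i : Fin L.kJ) :
    mkPt nt nJ c (ptEquiv L (Sum.inl (Sum.inr i))) = nJ i := by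
  simp [mkPt]

omit [Field F] [DecidableEq F] in
/-- The value coordinate of a point. [folklore] -/
@[simp] theorem mkPt_val (nt : Fin L.kt → F) (nJ : Fin L.kJ → F) (c : F) (i : Fin 1) :
    mkPt nt nJ c (ptEquiv L (Sum.inr i)) = c := by
  simp [mkPt]

omit [Field F] [DecidableEq F] in
/-- Points are determined by their data. [folklore] -/
theorem mkPt_inj {nt nt' : Fin L.kt → F} {nJ nJ' : Fin L.kJ → F} {c c' : F} (h : mkPt nt nJ c = mkPt nt' nJ' c') :
    nt = nt' ∧ nJ = nJ' ∧ c = c' := by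
  refine ⟨funext fun i => ?_, funext fun i => ?_, ?_⟩
  · have := congrFun h (ptEquiv L (Sum.inl (Sum.inl i))); simpa using this
  · have := congrFun h (ptEquiv L (Sum.inl (Sum.inr i))); simpa using this
  · have := congrFun h (ptEquiv L (Sum.inr 0)); simpa using this

/-- Constant digits of a number, as address sources. [folklore] -/
def constDig (h : ℕ) {k K : ℕ} (N : ℕ) : Fin k → Fin K ⊕ F := fun i => Sum.inr ((digitsOf h N i : ℕ) : F)

/-- Digits read off index coordinates, as address sources. [folklore] -/
def varDig {k K : ℕ} (slot : Fin k → Fin K) : Fin k → Fin K ⊕ F := fun i => Sum.inl (slot i)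

/-! ### Clause polynomials -/

section Polys

variable {K r : ℕ}

/-- The read variable `j`. [folklore] -/
def rd (j : Fin r) : MvPolynomial (Fin K ⊕ Fin r) F := X (Sum.inr j)

/-- **The polynomial of a premise/conclusion clause** on the reads:
`∏_{premises} Y · ∏_{conclusions} (1 - Y)` — it vanishes on Boolean reads iff the clause holds.
[cite: BabaiFortnowLund1991, §4] -/
def clausePoly (prem concl : List (Fin r)) : MvPolynomial (Fin K ⊕ Fin r) F :=
  (prem.map fun j => rd (F := F) (K := K) j).prod * (concl.map fun j => 1 - rd (F := F) (K := K) j).prod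

omit [DecidableEq F] in
/-- Value of a clause polynomial. [folklore] -/
theorem eval_clausePoly (pt : Fin K ⊕ Fin r → F) (prem concl : List (Fin r)) :
    MvPolynomial.eval pt (clausePoly (F := F) prem concl) =
      (prem.map fun j => pt (Sum.inr j)).prod * (concl.map fun j => 1 - pt (Sum.inr j)).prod := by
  unfold clausePoly rd
  rw [map_mul, map_list_prod, map_list_prod, List.map_map, List.map_map]
  congr 1 <;> congr 1 <;> refine List.map_congr_left fun j _ => ?_ <;> simp

end Polys

/-! ### The constraint families -/

section Families

variable (L) (n P T : ℕ)

local notation "d" => dM M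
local notation "K" => KIdx L (dM M)
local notation "m" => mPt L

/-- The digit variables of the row `t` of an index, inside the polynomial ring of a family. [folklore] -/
def Ut {r : ℕ} : Fin L.kt → Fin K ⊕ Fin r := fun i => Sum.inl (tSlot i)

/-- The digit variables of the row `t'`. [folklore] -/
def Ut' {r : ℕ} : Fin L.kt → Fin K ⊕ Fin r := fun i => Sum.inl (t'Slot i)

/-- The digit variables of the `c`-th column. [folklore] -/
def Uc {r : ℕ} (c : Fin (2 * d + 1)) : Fin L.kJ → Fin K ⊕ Fin r := fun i => Sum.inl (cSlot c i)

/-- **Unit family**: the entry at a constant address is `1` (`1 - Y = 0`). Used for the control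
block, the separator, the input bits and the accept clause. [cite: Sipser2012, Thm. 7.37 (φ_start, φ_accept)] -/
def unitFam (t0 J0 : ℕ) (v : Val M.tm) : Family F K m where
  arity := 1
  addr := fun _ => mkAddr (constDig L.h t0) (constDig L.h J0) (vcode M v)
  poly := 1 * clausePoly [] [0]

/-- **Empty tail of the start row**: for `NN + 1 ≤ J ≤ S₁`, block `(0, J)` is empty.
[cite: Sipser2012, Thm. 7.37 (φ_start)] -/
def tailFam (hd0 : 0 < 2 * d + 1) : Family F K m where
  arity := 1
  addr := fun _ => mkAddr (constDig L.h 0) (varDig (cSlot ⟨0, hd0⟩)) (vcode M (noneVal M.tm))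
  poly := (1 - LTC L.h L.kJ (NN n P + 1) (Uc M L ⟨0, hd0⟩)) * LTC L.h L.kJ (S1 M n P T + 1) (Uc M L ⟨0, hd0⟩) *
    clausePoly [] [0]

/-- The three admissible values of a certificate cell. [folklore] -/
def certVal (k : Fin 3) : Val M.tm := ![symVal M false, symVal M true, noneVal M.tm] k

/-- **Certificate cell `j`** of the start row holds an input symbol or is empty.
[cite: Sipser2012, Thm. 7.37 (φ_start)] -/
def certAnyFam (j : ℕ) : Family F K m where
  arity := 3
  addr := fun k => mkAddr (constDig L.h 0) (constDig L.h (2 * n + 3 + j)) (vcode M (certVal M k))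
  poly := 1 * clausePoly [] [0, 1, 2]

/-- **Once empty, empty**: if certificate cell `j` is empty so is cell `j + 1`.
[cite: Sipser2012, Thm. 7.37 (φ_start)] -/
def certNextFam (j : ℕ) : Family F K m where
  arity := 2
  addr := fun k => mkAddr (constDig L.h 0) (constDig L.h (2 * n + 3 + j + k)) (vcode M (noneVal M.tm))
  poly := 1 * clausePoly [0] [1]

/-- The guard "`t < T` and `t' = t + 1`". [folklore] -/
def stepGuard {r : ℕ} : MvPolynomial (Fin K ⊕ Fin r) F :=
  LTC L.h L.kt T (Ut M L) * SUCC L.h L.kt (Ut M L) (Ut' M L)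

/-- **Top move family** for the value tuple `a` of blocks `0 … 3d` of row `t` and the block
`r ≤ 2d` of row `t + 1`: `[t < T][t' = t+1] · ∏ₛ Y(t, s, aₛ) · (1 - Y(t', r, topF a r)) = 0`.
[cite: Sipser2012, Thm. 7.37 (φ_move)] -/
def topFam (a : Fin (3 * d + 1) → Val M.tm) (r : Fin (2 * d + 1)) : Family F K m where
  arity := 3 * d + 2
  addr := @Fin.lastCases (3 * d + 1) (fun _ => Fin m → Fin K ⊕ F) (mkAddr (varDig t'Slot) (constDig L.h r) (vcode M (topF d a r)))
    fun s => mkAddr (varDig tSlot) (constDig L.h s) (vcode M (a s))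
  poly := stepGuard M L T *
    clausePoly ((List.finRange (3 * d + 1)).map Fin.castSucc) [Fin.last (3 * d + 1)]

/-- The guard of an interior window: consecutive columns `c₀, …, c_{2d}` with `d + 1 ≤ c₀` and
`c₀ < d + 1 + NN + d T`. [folklore] -/
def intGuard {r : ℕ} : MvPolynomial (Fin K ⊕ Fin r) F :=
  stepGuard M L T *
    ((List.finRange (2 * d)).map fun i : Fin (2 * d) =>
      SUCC L.h L.kJ (Uc M L (Fin.castSucc i)) (Uc M L i.succ)).prod *
    (1 - LTC L.h L.kJ (d + 1) (Uc M L ⟨0, by omega⟩)) * LTC L.h L.kJ (d + 1 + NN n P + d * T) (Uc M L ⟨0, by omega⟩)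

/-- **Interior move family** for the head tuple `hh` (blocks `0 … d` of row `t`) and the
neighbourhood tuple `nb` (blocks `J - d … J + d` of row `t`, `J = c_d`): the block `(t+1, J)` is
`intF d hh nb`. Reads: `d + 1` head entries, `2d + 1` neighbourhood entries, the conclusion.
[cite: Sipser2012, Thm. 7.37 (φ_move)] -/
def intFam (hh : Fin (d + 1) → Val M.tm) (nb : Fin (2 * d + 1) → Val M.tm) : Family F K m where
  arity := (d + 1) + (2 * d + 1) + 1
  addr := @Fin.lastCases ((d + 1) + (2 * d + 1)) (fun _ => Fin m → Fin K ⊕ F)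
    (mkAddr (varDig t'Slot) (varDig (cSlot ⟨d, by omega⟩)) (vcode M (intF d hh nb)))
    (@Fin.addCases (d + 1) (2 * d + 1) (fun _ => Fin m → Fin K ⊕ F)
      (fun s => mkAddr (varDig tSlot) (constDig L.h s) (vcode M (hh s)))
      (fun s => mkAddr (varDig tSlot) (varDig (cSlot s)) (vcode M (nb s))))
  poly := intGuard M L n P T *
    clausePoly (((List.finRange (d + 1)).map fun s => Fin.castSucc (Fin.castAdd (2 * d + 1) s)) ++
      ((List.finRange (2 * d + 1)).map fun s => Fin.castSucc (Fin.natAdd (d + 1) s)))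
      [Fin.last ((d + 1) + (2 * d + 1))]

/-- **Bottom family**: block `NN + d T + 2d + 1 + r` of row `t + 1` is empty (`r < d`).
[cite: Sipser2012, Thm. 7.37] -/
def botFam (r : ℕ) : Family F K m where
  arity := 1
  addr := fun _ => mkAddr (varDig t'Slot) (constDig L.h (NN n P + d * T + 2 * d + 1 + r)) (vcode M (noneVal M.tm))
  poly := stepGuard M L T * clausePoly [] [0]

/-- The guard of a tableau block: `t ≤ T` and `J ≤ S₁` (`J = c₀`). [folklore] -/
def cellGuard {r : ℕ} : MvPolynomial (Fin K ⊕ Fin r) F :=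
  LTC L.h L.kt (T + 1) (Ut M L) * LTC L.h L.kJ (S1 M n P T + 1) (Uc M L ⟨0, by omega⟩)

/-- The list of all block values, as a function on `Fin |Val|`. [folklore] -/
def valOf (j : Fin (Nat.card (Val M.tm))) : Val M.tm :=
  haveI := Fintype.ofFinite (Val M.tm); (Fintype.equivFin (Val M.tm)).symm (j.cast (Nat.card_eq_fintype_card))

/-- **At least one value per block.** [cite: Sipser2012, Thm. 7.37 (φ_cell)] -/
def cellAnyFam : Family F K m where
  arity := Nat.card (Val M.tm)
  addr := fun j => mkAddr (varDig tSlot) (varDig (cSlot ⟨0, by omega⟩)) (vcode M (valOf M j))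
  poly := cellGuard M L n P T * clausePoly [] (List.finRange _)

/-- **At most one value per block** (`v ≠ v'`). [cite: Sipser2012, Thm. 7.37 (φ_cell)] -/
def cellPairFam (v v' : Val M.tm) : Family F K m where
  arity := 2
  addr := fun k => mkAddr (varDig tSlot) (varDig (cSlot ⟨0, by omega⟩)) (vcode M (if (k : ℕ) = 0 then v else v'))
  poly := cellGuard M L n P T * clausePoly [0, 1] []

open scoped Classical in
/-- **The list of families of the arithmetized tableau** of `M` on an input of length `n` with
certificate bound `P` and time bound `T` (the bits of `x` enter through `xFams`).
[cite: BabaiFortnowLund1991, §4] [cite: Sipser2012, Thm. 7.37] -/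
def nFams : List (Family F K m) :=
  [unitFam M L 0 0 (ctrlVal M), unitFam M L 0 (2 * n + 1) (symVal M false), unitFam M L 0 (2 * n + 2) (symVal M true),
    tailFam M L n P T (by omega), unitFam M L T 1 (accVal M), cellAnyFam M L n P T] ++
  ((List.range P).flatMap fun j => [certAnyFam M L n j, certNextFam M L n j]) ++
  ((allTuples M (3 * d + 1)).flatMap fun a => (List.finRange (2 * d + 1)).map fun r => topFam M L T a r) ++
  ((allTuples M (d + 1)).flatMap fun hh => (allTuples M (2 * d + 1)).map fun nb => intFam M L n P T hh nb) ++
  ((List.range d).map fun r => botFam M L n P T r) ++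
  ((allVals M).flatMap fun v => (allVals M).flatMap fun v' => if v = v' then [] else [cellPairFam M L n P T v v'])

/-- The families of the bits of `x`: blocks `2i + 1`, `2i + 2` of row `0` hold the doubled bit.
[cite: Sipser2012, Thm. 7.37 (φ_start)] -/
def xFams (x : List Bool) : List (Family F K m) :=
  x.zipIdx.flatMap fun p => [unitFam M L 0 (2 * p.2 + 1) (symVal M p.1), unitFam M L 0 (2 * p.2 + 2) (symVal M p.1)]

/-- **The arithmetized Cook–Levin tableau** of `M` on `x` (certificate bound `P`, time bound `T`)
as an algebraic CSP over the tableau points. [cite: BabaiFortnowLund1991, §4] [cite: AroraBarakCC2009, §11.5.2] -/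
def tableauCSP (x : List Bool) : CSP F K m where
  N := (xFams M L x ++ nFams M L x.length P T).length
  fam := fun i => (xFams M L x ++ nFams M L x.length P T).get i

/-- A family of the list is a family of the CSP. [folklore] -/
theorem mem_fams_iff (x : List Bool) (φ : Family F K m) :
    (∃ i, (tableauCSP M L P T x).fam i = φ) ↔ φ ∈ xFams M L x ++ nFams M L x.length P T := by
  unfold tableauCSP
  constructor
  · rintro ⟨i, rfl⟩
    exact List.get_mem _ _
  · intro h
    obtain ⟨i, hi⟩ := List.get_of_mem h
    exact ⟨i, hi⟩

end Families

/-! ### Digits placed into points and indices -/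

section Digits

variable (L) {n P T : ℕ}

local notation "d" => dM M
local notation "m" => mPt L

/-- Digits of a value recover the digit vector. [folklore] -/
theorem digitsOf_dval {h k : ℕ} (hh : 0 < h) {nv : Fin k → ℕ} (hn : ∀ i, nv i < h) :
    digitsOf h (k := k) (dval h nv) = nv :=
  dval_injective h (fun i => digitsOf_lt hh _ i) hn (dval_digitsOf hh (dval_lt h nv hn))

/-- **The point of block `(t, J)` with value `v`**: digits of `t`, digits of `J`, code of `v`.
[cite: BabaiFortnowLund1991, §4] -/
def ptOf (t J : ℕ) (v : Val M.tm) : Fin m → F :=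
  mkPt (fun i => ((digitsOf L.h t i : ℕ) : F)) (fun i => ((digitsOf L.h J i : ℕ) : F)) (vcode M v)

/-- **The index with rows `t, t'` and columns `cols`.** [folklore] -/
def zOf (t t' : ℕ) (cols : Fin (2 * d + 1) → ℕ) : Fin (KIdx L (dM M)) → F := fun q =>
  match (idxEquiv L d).symm q with
  | Sum.inl (Sum.inl i) => ((digitsOf L.h t i : ℕ) : F)
  | Sum.inl (Sum.inr i) => ((digitsOf L.h t' i : ℕ) : F)
  | Sum.inr (c, i) => ((digitsOf L.h (cols c) i : ℕ) : F)

variable {L}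

omit [DecidableEq F] in
/-- Row digits of `zOf`. [folklore] -/
@[simp] theorem zOf_tSlot (t t' : ℕ) (cols : Fin (2 * d + 1) → ℕ) (i : Fin L.kt) :
    zOf M L t t' cols (tSlot i) = ((digitsOf L.h t i : ℕ) : F) := by
  simp [zOf, tSlot]

omit [DecidableEq F] in
/-- Second-row digits of `zOf`. [folklore] -/
@[simp] theorem zOf_t'Slot (t t' : ℕ) (cols : Fin (2 * d + 1) → ℕ) (i : Fin L.kt) :
    zOf M L t t' cols (t'Slot i) = ((digitsOf L.h t' i : ℕ) : F) := by
  simp [zOf, t'Slot]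

omit [DecidableEq F] in
/-- Column digits of `zOf`. [folklore] -/
@[simp] theorem zOf_cSlot (t t' : ℕ) (cols : Fin (2 * d + 1) → ℕ) (c : Fin (2 * d + 1)) (i : Fin L.kJ) :
    zOf M L t t' cols (cSlot c i) = ((digitsOf L.h (cols c) i : ℕ) : F) := by
  simp [zOf, cSlot]

/-- The coordinates of `zOf` are nodes (`0 < h`). [folklore] -/
theorem zOf_mem (hh : 0 < L.h) (t t' : ℕ) (cols : Fin (2 * d + 1) → ℕ) (q : Fin (KIdx L (dM M))) : zOf M L t t' cols q ∈ nodes (F := F) L.h := by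
  unfold zOf
  rcases (idxEquiv L d).symm q with (i | i) | ⟨c, i⟩
  · exact cast_mem_nodes (digitsOf_lt hh _ _)
  · exact cast_mem_nodes (digitsOf_lt hh _ _)
  · exact cast_mem_nodes (digitsOf_lt hh _ _)

omit [DecidableEq F] in
/-- Reading an address with row source `t`-digits of the index and constant column `J0`. [folklore] -/
theorem readAddr_var_const (t t' : ℕ) (cols : Fin (2 * d + 1) → ℕ) (J0 : ℕ) (v : Val M.tm) :
    readAddr (mkAddr ((varDig tSlot : Fin L.kt → Fin (KIdx L (dM M)) ⊕ F)) (constDig L.h J0) (vcode M v : F)) (zOf M L t t' cols) = ptOf M L t J0 v := by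
  rw [readAddr_mkAddr]
  unfold ptOf varDig constDig
  simp only [Sum.elim_inl, Sum.elim_inr, id_eq, zOf_tSlot]

omit [DecidableEq F] in
/-- Reading with row source `t'` and constant column. [folklore] -/
theorem readAddr_var'_const (t t' : ℕ) (cols : Fin (2 * d + 1) → ℕ) (J0 : ℕ) (v : Val M.tm) :
    readAddr (mkAddr ((varDig t'Slot : Fin L.kt → Fin (KIdx L (dM M)) ⊕ F)) (constDig L.h J0) (vcode M v : F)) (zOf M L t t' cols) = ptOf M L t' J0 v := by
  rw [readAddr_mkAddr]
  unfold ptOf varDig constDig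
  simp only [Sum.elim_inl, Sum.elim_inr, id_eq, zOf_t'Slot]

omit [DecidableEq F] in
/-- Reading with row source `t` and column source `c`. [folklore] -/
theorem readAddr_var_var (t t' : ℕ) (cols : Fin (2 * d + 1) → ℕ) (c : Fin (2 * d + 1)) (v : Val M.tm) :
    readAddr (mkAddr ((varDig tSlot : Fin L.kt → Fin (KIdx L (dM M)) ⊕ F)) (varDig (cSlot c)) (vcode M v : F)) (zOf M L t t' cols) = ptOf M L t (cols c) v := by
  rw [readAddr_mkAddr]
  unfold ptOf varDig
  simp only [Sum.elim_inl, zOf_tSlot, zOf_cSlot]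

omit [DecidableEq F] in
/-- Reading with row source `t'` and column source `c`. [folklore] -/
theorem readAddr_var'_var (t t' : ℕ) (cols : Fin (2 * d + 1) → ℕ) (c : Fin (2 * d + 1)) (v : Val M.tm) :
    readAddr (mkAddr ((varDig t'Slot : Fin L.kt → Fin (KIdx L (dM M)) ⊕ F)) (varDig (cSlot c)) (vcode M v : F)) (zOf M L t t' cols) = ptOf M L t' (cols c) v := by
  rw [readAddr_mkAddr]
  unfold ptOf varDig
  simp only [Sum.elim_inl, zOf_t'Slot, zOf_cSlot]

omit [DecidableEq F] in
/-- Reading a constant address (at any index). [folklore] -/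
theorem readAddr_const_const (t0 J0 : ℕ) (v : Val M.tm) (z : Fin (KIdx L (dM M)) → F) :
    readAddr (mkAddr ((constDig L.h t0 : Fin L.kt → Fin (KIdx L (dM M)) ⊕ F)) (constDig L.h J0) (vcode M v : F)) z = ptOf M L t0 J0 v := by
  rw [readAddr_mkAddr]
  unfold ptOf constDig
  simp only [Sum.elim_inr, id_eq]

omit [DecidableEq F] in
/-- Reading with constant row `t0` and column source `c`. [folklore] -/
theorem readAddr_const_var (t0 : ℕ) (t t' : ℕ) (cols : Fin (2 * d + 1) → ℕ) (c : Fin (2 * d + 1)) (v : Val M.tm) :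
    readAddr (mkAddr ((constDig L.h t0 : Fin L.kt → Fin (KIdx L (dM M)) ⊕ F)) (varDig (cSlot c)) (vcode M v : F)) (zOf M L t t' cols) = ptOf M L t0 (cols c) v := by
  rw [readAddr_mkAddr]
  unfold ptOf varDig constDig
  simp only [Sum.elim_inl, Sum.elim_inr, id_eq, zOf_cSlot]

end Digits

/-! ### Evaluating the guards at digit indices -/

section Guards

variable {n P T : ℕ} (hinj : ∀ a b : ℕ, a < L.h → b < L.h → (a : F) = b → a = b) (hh : 0 < L.h)
include hinj hh

local notation "d" => dM M
local notation "K" => KIdx L (dM M)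

/-- `[t < c]` at `zOf`. [folklore] -/
theorem eval_LTC_t {r : ℕ} (y : Fin r → F) (t t' : ℕ) (cols : Fin (2 * d + 1) → ℕ) (ht : t < L.h ^ L.kt) (c : ℕ) :
    MvPolynomial.eval (Sum.elim (zOf M L t t' cols) y) (LTC (F := F) L.h L.kt c (Ut M L)) = if t < c then 1 else 0 := by
  rw [eval_LTC hinj c (n := digitsOf L.h t) (fun i => digitsOf_lt hh _ i) (fun i => ?_), dval_digitsOf hh ht]
  show Sum.elim (zOf M L t t' cols) y (Sum.inl (tSlot i)) = _
  rw [Sum.elim_inl, zOf_tSlot]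

/-- `[c₀-type column < c]` at `zOf`. [folklore] -/
theorem eval_LTC_c {r : ℕ} (y : Fin r → F) (t t' : ℕ) (cols : Fin (2 * d + 1) → ℕ) (cc : Fin (2 * d + 1))
    (hc : cols cc < L.h ^ L.kJ) (c : ℕ) :
    MvPolynomial.eval (Sum.elim (zOf M L t t' cols) y) (LTC (F := F) L.h L.kJ c (Uc M L cc)) = if cols cc < c then 1 else 0 := by
  rw [eval_LTC hinj c (n := digitsOf L.h (cols cc)) (fun i => digitsOf_lt hh _ i) (fun i => ?_), dval_digitsOf hh hc]
  show Sum.elim (zOf M L t t' cols) y (Sum.inl (cSlot cc i)) = _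
  rw [Sum.elim_inl, zOf_cSlot]

/-- `[t' = t + 1]` at `zOf`. [folklore] -/
theorem eval_SUCC_t {r : ℕ} (y : Fin r → F) (t t' : ℕ) (cols : Fin (2 * d + 1) → ℕ) (ht : t < L.h ^ L.kt) (ht' : t' < L.h ^ L.kt) :
    MvPolynomial.eval (Sum.elim (zOf M L t t' cols) y) (SUCC (F := F) L.h L.kt (Ut M L) (Ut' M L)) = if t' = t + 1 then 1 else 0 := by
  rw [eval_SUCC hinj (n := digitsOf L.h t) (n' := digitsOf L.h t') (fun i => digitsOf_lt hh _ i) (fun i => digitsOf_lt hh _ i)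
    (fun i => ?_) (fun i => ?_), dval_digitsOf hh ht, dval_digitsOf hh ht']
  · show Sum.elim (zOf M L t t' cols) y (Sum.inl (tSlot i)) = _
    rw [Sum.elim_inl, zOf_tSlot]
  · show Sum.elim (zOf M L t t' cols) y (Sum.inl (t'Slot i)) = _
    rw [Sum.elim_inl, zOf_t'Slot]

/-- `[c_{i+1} = c_i + 1]` at `zOf`. [folklore] -/
theorem eval_SUCC_c {r : ℕ} (y : Fin r → F) (t t' : ℕ) (cols : Fin (2 * d + 1) → ℕ) (a b : Fin (2 * d + 1))
    (ha : cols a < L.h ^ L.kJ) (hb : cols b < L.h ^ L.kJ) :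
    MvPolynomial.eval (Sum.elim (zOf M L t t' cols) y) (SUCC (F := F) L.h L.kJ (Uc M L a) (Uc M L b)) =
      if cols b = cols a + 1 then 1 else 0 := by
  rw [eval_SUCC hinj (n := digitsOf L.h (cols a)) (n' := digitsOf L.h (cols b)) (fun i => digitsOf_lt hh _ i)
    (fun i => digitsOf_lt hh _ i) (fun i => ?_) (fun i => ?_), dval_digitsOf hh ha, dval_digitsOf hh hb]
  · show Sum.elim (zOf M L t t' cols) y (Sum.inl (cSlot a i)) = _
    rw [Sum.elim_inl, zOf_cSlot]
  · show Sum.elim (zOf M L t t' cols) y (Sum.inl (cSlot b i)) = _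
    rw [Sum.elim_inl, zOf_cSlot]

/-- The step guard at `zOf t (t+1)`, `t < T < h^{kt}`, is `1`. [folklore] -/
theorem eval_stepGuard {r : ℕ} (y : Fin r → F) {t : ℕ} (cols : Fin (2 * d + 1) → ℕ) (htT : t < T) (hT : T < L.h ^ L.kt) :
    MvPolynomial.eval (Sum.elim (zOf M L t (t + 1) cols) y) (stepGuard (F := F) (r := r) M L T) = 1 := by
  unfold stepGuard
  rw [map_mul, eval_LTC_t M hinj hh y t (t + 1) cols (by omega) T, eval_SUCC_t M hinj hh y t (t + 1) cols (by omega) (by omega),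
    if_pos htT, if_pos rfl, mul_one]

/-- The cell guard at `zOf t t' cols` with `t ≤ T`, `cols 0 ≤ S₁` is `1`. [folklore] -/
theorem eval_cellGuard {r : ℕ} (y : Fin r → F) {t t' : ℕ} {cols : Fin (2 * d + 1) → ℕ} (htT : t ≤ T) (hT : T < L.h ^ L.kt)
    (hJ : cols ⟨0, by omega⟩ ≤ S1 M n P T) (hS : S1 M n P T < L.h ^ L.kJ) :
    MvPolynomial.eval (Sum.elim (zOf M L t t' cols) y) (cellGuard (F := F) (r := r) M L n P T) = 1 := by
  unfold cellGuard
  rw [map_mul, eval_LTC_t M hinj hh y t t' cols (by omega) (T + 1), eval_LTC_c M hinj hh y t t' cols ⟨0, by omega⟩ (by omega),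
    if_pos (by omega), if_pos (by omega), mul_one]

/-- The tail guard at `zOf 0 0 (fun _ => NN + 1 + j)`, `j < dT + 3d`, is `1`. [folklore] -/
theorem eval_tailGuard {r : ℕ} (y : Fin r → F) {j : ℕ} (hj : j < d * T + 3 * d) (hS : S1 M n P T < L.h ^ L.kJ) (hd0 : 0 < 2 * d + 1) :
    MvPolynomial.eval (Sum.elim (zOf M L 0 0 fun _ => NN n P + 1 + j) y)
      ((1 - LTC L.h L.kJ (NN n P + 1) (Uc M L ⟨0, hd0⟩)) * LTC L.h L.kJ (S1 M n P T + 1) (Uc M L ⟨0, hd0⟩) :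
        MvPolynomial (Fin K ⊕ Fin r) F) = 1 := by
  have hS1 : S1 M n P T = NN n P + d * T + 3 * d := rfl
  have hcol : NN n P + 1 + j < L.h ^ L.kJ := by omega
  rw [map_mul, map_sub, map_one, eval_LTC_c M hinj hh y 0 0 _ ⟨0, hd0⟩ hcol, eval_LTC_c M hinj hh y 0 0 _ ⟨0, hd0⟩ hcol,
    if_neg (show ¬ NN n P + 1 + j < NN n P + 1 by omega), if_pos (show NN n P + 1 + j < S1 M n P T + 1 by omega), sub_zero, mul_one]

/-- The interior guard at `zOf t (t+1) (fun s => d + 1 + j + s)`, `t < T`, `j < NN + dT`, is `1`. [folklore] -/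
theorem eval_intGuard {r : ℕ} (y : Fin r → F) {t j : ℕ} (htT : t < T) (hT : T < L.h ^ L.kt) (hj : j < NN n P + d * T)
    (hS : S1 M n P T < L.h ^ L.kJ) :
    MvPolynomial.eval (Sum.elim (zOf M L t (t + 1) fun s : Fin (2 * d + 1) => d + 1 + j + s) y) (intGuard (F := F) (r := r) M L n P T) = 1 := by
  have hS1 : S1 M n P T = NN n P + d * T + 3 * d := rfl
  have hcol : ∀ s : Fin (2 * d + 1), d + 1 + j + (s : ℕ) < L.h ^ L.kJ := fun s => by have := s.2; omega
  unfold intGuard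
  rw [map_mul, map_mul, map_mul, eval_stepGuard M hinj hh y _ htT hT, map_list_prod, List.map_map, map_sub, map_one,
    eval_LTC_c M hinj hh y t (t + 1) _ ⟨0, by omega⟩ (hcol _), eval_LTC_c M hinj hh y t (t + 1) _ ⟨0, by omega⟩ (hcol _),
    if_neg (show ¬ d + 1 + j + 0 < d + 1 by omega), if_pos (show d + 1 + j + 0 < d + 1 + NN n P + d * T by omega),
    List.prod_eq_one, sub_zero, mul_one, mul_one, mul_one]
  intro a ha
  obtain ⟨i, -, rfl⟩ := List.mem_map.1 ha
  simp only [Function.comp_apply]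
  rw [eval_SUCC_c M hinj hh y t (t + 1) _ (Fin.castSucc i) i.succ (hcol _) (hcol _), if_pos]
  simp only [Fin.val_castSucc, Fin.val_succ]
  omega

/-- The step guard at a digit index, as an indicator. [folklore] -/
theorem eval_stepGuard_if {r : ℕ} (y : Fin r → F) {t t' : ℕ} (cols : Fin (2 * d + 1) → ℕ) (ht : t < L.h ^ L.kt) (ht' : t' < L.h ^ L.kt) :
    MvPolynomial.eval (Sum.elim (zOf M L t t' cols) y) (stepGuard (F := F) (r := r) M L T) = if t < T ∧ t' = t + 1 then 1 else 0 := by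
  unfold stepGuard
  rw [map_mul, eval_LTC_t M hinj hh y t t' cols ht T, eval_SUCC_t M hinj hh y t t' cols ht ht']
  by_cases h1 : t < T <;> by_cases h2 : t' = t + 1
  · rw [if_pos h1, if_pos h2, if_pos ⟨h1, h2⟩, mul_one]
  · rw [if_pos h1, if_neg h2, if_neg fun h => h2 h.2, mul_zero]
  · rw [if_neg h1, if_pos h2, if_neg fun h => h1 h.1, zero_mul]
  · rw [if_neg h1, if_neg h2, if_neg fun h => h1 h.1, mul_zero]

/-- The cell guard at a digit index, as an indicator. [folklore] -/
theorem eval_cellGuard_if {r : ℕ} (y : Fin r → F) {t t' : ℕ} (cols : Fin (2 * d + 1) → ℕ) (ht : t < L.h ^ L.kt)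
    (hc : cols ⟨0, by omega⟩ < L.h ^ L.kJ) :
    MvPolynomial.eval (Sum.elim (zOf M L t t' cols) y) (cellGuard (F := F) (r := r) M L n P T) =
      if t < T + 1 ∧ cols ⟨0, by omega⟩ < S1 M n P T + 1 then 1 else 0 := by
  unfold cellGuard
  rw [map_mul, eval_LTC_t M hinj hh y t t' cols ht (T + 1), eval_LTC_c M hinj hh y t t' cols ⟨0, by omega⟩ hc]
  by_cases h1 : t < T + 1 <;> by_cases h2 : cols ⟨0, by omega⟩ < S1 M n P T + 1
  · rw [if_pos h1, if_pos h2, if_pos ⟨h1, h2⟩, mul_one]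
  · rw [if_pos h1, if_neg h2, if_neg fun h => h2 h.2, mul_zero]
  · rw [if_neg h1, if_pos h2, if_neg fun h => h1 h.1, zero_mul]
  · rw [if_neg h1, if_neg h2, if_neg fun h => h1 h.1, mul_zero]

/-- The tail guard at a digit index, as an indicator. [folklore] -/
theorem eval_tailGuard_if {r : ℕ} (y : Fin r → F) {t t' : ℕ} (cols : Fin (2 * d + 1) → ℕ) (hd0 : 0 < 2 * d + 1)
    (hc : cols ⟨0, hd0⟩ < L.h ^ L.kJ) :
    MvPolynomial.eval (Sum.elim (zOf M L t t' cols) y)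
      ((1 - LTC L.h L.kJ (NN n P + 1) (Uc M L ⟨0, hd0⟩)) * LTC L.h L.kJ (S1 M n P T + 1) (Uc M L ⟨0, hd0⟩) :
        MvPolynomial (Fin K ⊕ Fin r) F) = if ¬ cols ⟨0, hd0⟩ < NN n P + 1 ∧ cols ⟨0, hd0⟩ < S1 M n P T + 1 then 1 else 0 := by
  rw [map_mul, map_sub, map_one, eval_LTC_c M hinj hh y t t' cols ⟨0, hd0⟩ hc, eval_LTC_c M hinj hh y t t' cols ⟨0, hd0⟩ hc]
  by_cases h1 : cols ⟨0, hd0⟩ < NN n P + 1 <;> by_cases h2 : cols ⟨0, hd0⟩ < S1 M n P T + 1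
  · rw [if_pos h1, if_pos h2, if_neg fun h => h.1 h1, sub_self, zero_mul]
  · rw [if_pos h1, if_neg h2, if_neg fun h => h.1 h1, mul_zero]
  · rw [if_neg h1, if_pos h2, if_pos ⟨h1, h2⟩, sub_zero, mul_one]
  · rw [if_neg h1, if_neg h2, if_neg fun h => h2 h.2, mul_zero]

variable (n P T) in
/-- **The interior guard vanishes unless the index is an interior window**: rows `t < T`, `t' = t+1`,
consecutive columns starting at `c₀` with `d + 1 ≤ c₀ < d + 1 + NN + dT`. [folklore] -/
theorem eval_intGuard_eq_zero_or {r : ℕ} (y : Fin r → F) {t t' : ℕ} (cols : Fin (2 * d + 1) → ℕ) (ht : t < L.h ^ L.kt)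
    (ht' : t' < L.h ^ L.kt) (hc : ∀ c, cols c < L.h ^ L.kJ) :
    MvPolynomial.eval (Sum.elim (zOf M L t t' cols) y) (intGuard (F := F) (r := r) M L n P T) = 0 ∨
      (t < T ∧ t' = t + 1 ∧ (∀ i : Fin (2 * d), cols i.succ = cols (Fin.castSucc i) + 1) ∧
        ¬ cols ⟨0, by omega⟩ < d + 1 ∧ cols ⟨0, by omega⟩ < d + 1 + NN n P + d * T) := by
  unfold intGuard
  rw [map_mul, map_mul, map_mul, eval_stepGuard_if M hinj hh y cols ht ht', map_list_prod, List.map_map, map_sub, map_one,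
    eval_LTC_c M hinj hh y t t' cols ⟨0, by omega⟩ (hc _), eval_LTC_c M hinj hh y t t' cols ⟨0, by omega⟩ (hc _)]
  by_cases hst : t < T ∧ t' = t + 1
  · by_cases hsucc : ∀ i : Fin (2 * d), cols i.succ = cols (Fin.castSucc i) + 1
    · by_cases h3 : cols ⟨0, by omega⟩ < d + 1
      · left
        rw [if_pos h3, sub_self, mul_zero, zero_mul]
      · by_cases h4 : cols ⟨0, by omega⟩ < d + 1 + NN n P + d * T
        · exact Or.inr ⟨hst.1, hst.2, hsucc, h3, h4⟩
        · left
          rw [if_neg h4, mul_zero]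
    · left
      push Not at hsucc
      obtain ⟨i, hi⟩ := hsucc
      have h0 : ((List.finRange (2 * d)).map (MvPolynomial.eval (Sum.elim (zOf M L t t' cols) y) ∘ fun i : Fin (2 * d) =>
          SUCC L.h L.kJ (Uc M L (Fin.castSucc i)) (Uc M L i.succ))).prod = 0 := by
        refine List.prod_eq_zero (List.mem_map.2 ⟨i, List.mem_finRange i, ?_⟩)
        simp only [Function.comp_apply]
        rw [eval_SUCC_c M hinj hh y t t' cols (Fin.castSucc i) i.succ (hc _) (hc _), if_neg hi]
      rw [h0, mul_zero, zero_mul, zero_mul]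
  · left
    rw [if_neg hst, zero_mul, zero_mul, zero_mul]

end Guards

/-! ### From the CSP to the clauses: decoding a satisfying oracle -/

section ToClauses

variable {x : List Bool} {P T : ℕ}
  (hinj : ∀ a b : ℕ, a < L.h → b < L.h → (a : F) = b → a = b) (hh : 0 < L.h)
  (hT : T < L.h ^ L.kt) (hS : S1 M x.length P T < L.h ^ L.kJ)
  {Y : (Fin (mPt L) → F) → F} (hY : (tableauCSP M L P T x).Satisfies (nodes (F := F) L.h) Y)

local notation "d" => dM M
local notation "n" => x.length
local notation "β" => blk M (List.length x) P T
local notation "SS" => S1 M (List.length x) P T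

/-- **The decoded assignment**: block `b` holds `v` iff the oracle is `1` at the point of
`(b / RB, b % RB, v)`. [cite: BabaiFortnowLund1991, §4] -/
def τOf (L : Layout) (x : List Bool) (P T : ℕ) (Y : (Fin (mPt L) → F) → F) : TVar M → Bool := fun bv =>
  decide (Y (ptOf M L (bv.1 / RB M x.length P T) (bv.1 % RB M x.length P T) bv.2) = 1)

/-- The decoded assignment on the tableau. [folklore] -/
theorem τOf_blk {t J : ℕ} (hJ : J ≤ SS) (v : Val M.tm) :
    τOf M L x P T Y (β t J, v) = true ↔ Y (ptOf M L t J v) = 1 := by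
  unfold τOf
  rw [decide_eq_true_eq, blk_div M n P T hJ, blk_mod M n P T hJ]

/-- The point attached to a tableau variable `(b, v)`. [folklore] -/
def ptVar (L : Layout) (x : List Bool) (P T : ℕ) (bv : TVar M) : Fin (mPt L) → F :=
  ptOf M L (bv.1 / RB M x.length P T) (bv.1 % RB M x.length P T) bv.2

/-- The decoded assignment reads the oracle at the attached point. [folklore] -/
theorem τOf_iff (w : TVar M) : τOf M L x P T Y w = true ↔ Y (ptVar M L x P T w) = 1 := by
  unfold τOf ptVar
  rw [decide_eq_true_eq]

omit [DecidableEq F] in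
/-- On the tableau the attached point is the block point. [folklore] -/
theorem ptVar_blk {t J : ℕ} (hJ : J ≤ SS) (v : Val M.tm) : (ptVar M L x P T (β t J, v) : Fin (mPt L) → F) = ptOf M L t J v := by
  unfold ptVar
  rw [blk_div M n P T hJ, blk_mod M n P T hJ]

/-- A listed family vanishes at every node index. [folklore] -/
theorem eval_eq_zero_of_mem (hY : (tableauCSP M L P T x).Satisfies (nodes (F := F) L.h) Y) {φ : Family F (KIdx L d) (mPt L)}
    (hφ : φ ∈ xFams M L x ++ nFams M L x.length P T) (z : Fin (KIdx L d) → F) (hz : ∀ q, z q ∈ nodes (F := F) L.h) :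
    φ.eval Y z = 0 := by
  obtain ⟨i, hi⟩ := (mem_fams_iff M L P T x φ).2 hφ
  rw [← hi]
  exact hY.eval_eq_zero i z hz

omit [DecidableEq F] in
/-- The value of a family with polynomial `guard · clausePoly prem concl`. [folklore] -/
theorem eval_guard_clause {Kk mm r : ℕ} (G : MvPolynomial (Fin Kk ⊕ Fin r) F) (prem concl : List (Fin r))
    (addr : Fin r → Fin mm → Fin Kk ⊕ F) (Yy : (Fin mm → F) → F) (z : Fin Kk → F) :
    (⟨r, addr, G * clausePoly prem concl⟩ : Family F Kk mm).eval Yy z =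
      MvPolynomial.eval (Sum.elim z fun j => Yy (readAddr (addr j) z)) G *
        ((prem.map fun j => Yy (readAddr (addr j) z)).prod * (concl.map fun j => 1 - Yy (readAddr (addr j) z)).prod) := by
  unfold Family.eval Family.value
  rw [map_mul, eval_clausePoly]
  rfl

omit [DecidableEq F] in
/-- **Clause reading of a vanishing product**: if the guard is nonzero and all premise reads are
`1`, some conclusion read is `1`. [folklore] -/
theorem exists_concl_of_eval_zero {g : F} {ps cs : List F} (hg : g ≠ 0) (hps : ∀ a ∈ ps, a = 1)
    (h : g * (ps.prod * (cs.map fun c => 1 - c).prod) = 0) : ∃ c ∈ cs, c = 1 := by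
  have hp : ps.prod = 1 := List.prod_eq_one hps
  rw [hp, one_mul, mul_eq_zero] at h
  rcases h with h | h
  · exact absurd h hg
  · have hmem : (0 : F) ∈ cs.map (fun c => 1 - c) := List.prod_eq_zero_iff.1 h
    obtain ⟨c, hc, hc0⟩ := List.mem_map.1 hmem
    exact ⟨c, hc, (sub_eq_zero.1 hc0).symm⟩

/-- **A clause holds under the decoded assignment** once a family of the CSP, at a node index
with nonzero guard, reads only literals of the clause: premise reads among the premises,
conclusion reads among the conclusions. [folklore] -/
theorem holds_of_family (hY : (tableauCSP M L P T x).Satisfies (nodes (F := F) L.h) Y) {r : ℕ}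
    (G : MvPolynomial (Fin (KIdx L d) ⊕ Fin r) F) (prem concl : List (Fin r))
    (addr : Fin r → Fin (mPt L) → Fin (KIdx L d) ⊕ F)
    (hmem : (⟨r, addr, G * clausePoly prem concl⟩ : Family F (KIdx L d) (mPt L)) ∈ xFams M L x ++ nFams M L x.length P T)
    (z : Fin (KIdx L d) → F) (hz : ∀ q, z q ∈ nodes (F := F) L.h)
    (hG : MvPolynomial.eval (Sum.elim z fun j => Y (readAddr (addr j) z)) G ≠ 0)
    (cl : HClause (TVar M))
    (hprem : ∀ j ∈ prem, ∃ w ∈ cl.1, readAddr (addr j) z = ptVar M L x P T w)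
    (hconcl : ∀ j ∈ concl, ∃ w ∈ cl.2, readAddr (addr j) z = ptVar M L x P T w) :
    HClause.Holds (τOf M L x P T Y) cl := by
  intro hall
  have h0 := eval_eq_zero_of_mem M hY hmem z hz
  rw [eval_guard_clause] at h0
  have hcs : (concl.map fun j => 1 - Y (readAddr (addr j) z)) = (concl.map fun j => Y (readAddr (addr j) z)).map fun c => 1 - c := by
    rw [List.map_map]; rfl
  rw [hcs] at h0
  have hps : ∀ a ∈ prem.map (fun j => Y (readAddr (addr j) z)), a = 1 := by
    intro a ha
    obtain ⟨j, hj, rfl⟩ := List.mem_map.1 ha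
    obtain ⟨w, hw, hjw⟩ := hprem j hj
    rw [hjw]
    exact (τOf_iff M w).1 (hall w hw)
  obtain ⟨c, hc, hc1⟩ := exists_concl_of_eval_zero hG hps h0
  obtain ⟨j, hj, rfl⟩ := List.mem_map.1 hc
  obtain ⟨w, hw, hjw⟩ := hconcl j hj
  rw [hjw] at hc1
  exact ⟨w, hw, (τOf_iff M w).2 hc1⟩

/-! #### Membership of the families in the list -/

/-- A family of `nFams` is a family of the CSP list. [folklore] -/
theorem mem_of_mem_nFams {φ : Family F (KIdx L d) (mPt L)} (h : φ ∈ nFams M L x.length P T) :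
    φ ∈ xFams M L x ++ nFams M L x.length P T := List.mem_append_right _ h

/-- The head families. [folklore] -/
theorem mem_nFams_head {φ : Family F (KIdx L d) (mPt L)}
    (h : φ ∈ [unitFam M L 0 0 (ctrlVal M), unitFam M L 0 (2 * n + 1) (symVal M false), unitFam M L 0 (2 * n + 2) (symVal M true),
      tailFam M L n P T (by omega), unitFam M L T 1 (accVal M), cellAnyFam M L n P T]) :
    φ ∈ xFams M L x ++ nFams M L x.length P T := by
  refine mem_of_mem_nFams M ?_
  unfold nFams
  exact List.mem_append_left _ (List.mem_append_left _ (List.mem_append_left _ (List.mem_append_left _ (List.mem_append_left _ h))))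

/-- The certificate families. [folklore] -/
theorem mem_nFams_cert {j : ℕ} (hj : j < P) {φ : Family F (KIdx L d) (mPt L)} (h : φ ∈ [certAnyFam M L n j, certNextFam M L n j]) :
    φ ∈ xFams M L x ++ nFams M L x.length P T := by
  refine mem_of_mem_nFams M ?_
  unfold nFams
  refine List.mem_append_left _ (List.mem_append_left _ (List.mem_append_left _ (List.mem_append_left _ (List.mem_append_right _ ?_))))
  exact List.mem_flatMap.2 ⟨j, List.mem_range.2 hj, h⟩

/-- The top families. [folklore] -/
theorem mem_nFams_top (a : Fin (3 * d + 1) → Val M.tm) (r : Fin (2 * d + 1)) :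
    (topFam M L T a r : Family F (KIdx L d) (mPt L)) ∈ xFams M L x ++ nFams M L x.length P T := by
  refine mem_of_mem_nFams M ?_
  unfold nFams
  refine List.mem_append_left _ (List.mem_append_left _ (List.mem_append_left _ (List.mem_append_right _ ?_)))
  exact List.mem_flatMap.2 ⟨a, mem_allTuples M a, List.mem_map.2 ⟨r, List.mem_finRange r, rfl⟩⟩

/-- The interior families. [folklore] -/
theorem mem_nFams_int (hd : Fin (d + 1) → Val M.tm) (nb : Fin (2 * d + 1) → Val M.tm) :
    (intFam M L n P T hd nb : Family F (KIdx L d) (mPt L)) ∈ xFams M L x ++ nFams M L x.length P T := by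
  refine mem_of_mem_nFams M ?_
  unfold nFams
  refine List.mem_append_left _ (List.mem_append_left _ (List.mem_append_right _ ?_))
  exact List.mem_flatMap.2 ⟨hd, mem_allTuples M hd, List.mem_map.2 ⟨nb, mem_allTuples M nb, rfl⟩⟩

/-- The bottom families. [folklore] -/
theorem mem_nFams_bot {r : ℕ} (hr : r < d) : (botFam M L n P T r : Family F (KIdx L d) (mPt L)) ∈ xFams M L x ++ nFams M L x.length P T := by
  refine mem_of_mem_nFams M ?_
  unfold nFams
  refine List.mem_append_left _ (List.mem_append_right _ ?_)
  exact List.mem_map.2 ⟨r, List.mem_range.2 hr, rfl⟩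

/-- The pair families. [folklore] -/
theorem mem_nFams_pair {v v' : Val M.tm} (hvv : v ≠ v') :
    (cellPairFam M L n P T v v' : Family F (KIdx L d) (mPt L)) ∈ xFams M L x ++ nFams M L x.length P T := by
  classical
  refine mem_of_mem_nFams M ?_
  unfold nFams
  refine List.mem_append_right _ (List.mem_flatMap.2 ⟨v, mem_allVals M v, List.mem_flatMap.2 ⟨v', mem_allVals M v', ?_⟩⟩)
  rw [if_neg hvv]
  exact List.mem_singleton.2 rfl

/-- The bit families. [folklore] -/
theorem mem_xFams_bit {i : ℕ} {b : Bool} (hbi : (b, i) ∈ x.zipIdx) {φ : Family F (KIdx L d) (mPt L)}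
    (h : φ ∈ [unitFam M L 0 (2 * i + 1) (symVal M b), unitFam M L 0 (2 * i + 2) (symVal M b)]) :
    φ ∈ xFams M L x ++ nFams M L x.length P T :=
  List.mem_append_left _ (List.mem_flatMap.2 ⟨(b, i), hbi, h⟩)

/-! #### The clauses hold under the decoded assignment -/

section Shapes

include hh hY in
/-- **A unit family forces its literal.** [folklore] -/
theorem holds_unit' {t0 J0 : ℕ} (hJ0 : J0 ≤ SS) {v : Val M.tm}
    (hmem : (unitFam M L t0 J0 v : Family F (KIdx L d) (mPt L)) ∈ xFams M L x ++ nFams M L x.length P T) :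
    HClause.Holds (τOf M L x P T Y) ([], [(β t0 J0, v)]) := by
  refine holds_of_family M hY 1 [] [0] _ hmem (zOf M L 0 0 fun _ => 0) (zOf_mem M hh _ _ _)
    (by rw [map_one]; exact one_ne_zero) _ (by simp) fun j hj => ⟨_, List.mem_singleton.2 rfl, ?_⟩
  rw [ptVar_blk M hJ0, readAddr_const_const]

include hh hY in
/-- **The certificate families force their clauses** (`j < P`). [cite: Sipser2012, Thm. 7.37 (φ_start)] -/
theorem holds_cert {j : ℕ} (hj : j < P) :
    HClause.Holds (τOf M L x P T Y) ([], [(β 0 (2 * n + 3 + j), symVal M false), (β 0 (2 * n + 3 + j), symVal M true),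
        (β 0 (2 * n + 3 + j), noneVal M.tm)]) ∧
    HClause.Holds (τOf M L x P T Y) ([(β 0 (2 * n + 3 + j), noneVal M.tm)], [(β 0 (2 * n + 4 + j), noneVal M.tm)]) := by
  have hS1 : SS = NN n P + d * T + 3 * d := rfl
  have hN : NN n P = 2 * n + 2 + P := rfl
  have hd1 : 1 ≤ d := by unfold dM; omega
  have hc : 2 * n + 3 + j ≤ SS := by omega
  have hc' : 2 * n + 4 + j ≤ SS := by nlinarith
  constructor
  · refine holds_of_family M hY 1 [] [0, 1, 2] _
      (mem_nFams_cert M hj (φ := certAnyFam M L n j) (by simp))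
      (zOf M L 0 0 fun _ => 0) (zOf_mem M hh _ _ _) (by rw [map_one]; exact one_ne_zero) _ (by simp) fun k hk => ?_
    refine ⟨(β 0 (2 * n + 3 + j), certVal M k), ?_, by rw [ptVar_blk M hc, readAddr_const_const]⟩
    simp only [List.mem_cons, List.mem_nil_iff, or_false] at hk
    rcases hk with rfl | rfl | rfl <;> simp [certVal]
  · refine holds_of_family M hY 1 [0] [1] _
      (mem_nFams_cert M hj (φ := certNextFam M L n j) (by simp))
      (zOf M L 0 0 fun _ => 0) (zOf_mem M hh _ _ _) (by rw [map_one]; exact one_ne_zero) _ (fun k hk => ?_) fun k hk => ?_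
    · simp only [List.mem_cons, List.mem_nil_iff, or_false] at hk
      subst hk
      exact ⟨_, List.mem_singleton.2 rfl, by rw [ptVar_blk M hc, readAddr_const_const]; rfl⟩
    · simp only [List.mem_cons, List.mem_nil_iff, or_false] at hk
      subst hk
      refine ⟨_, List.mem_singleton.2 rfl, ?_⟩
      rw [ptVar_blk M hc', readAddr_const_const, Fin.val_one, show 2 * n + 3 + j + 1 = 2 * n + 4 + j by omega]

include hinj hh hS hY in
/-- **The tail family forces the empty tail** (`j < dT + 3d`). [cite: Sipser2012, Thm. 7.37 (φ_start)] -/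
theorem holds_tail {j : ℕ} (hj : j < d * T + 3 * d) : HClause.Holds (τOf M L x P T Y) ([], [(β 0 (NN n P + 1 + j), noneVal M.tm)]) := by
  have hS1 : SS = NN n P + d * T + 3 * d := rfl
  have hJ : NN n P + 1 + j ≤ SS := by omega
  refine holds_of_family M hY _ [] [0] _ (mem_nFams_head M (φ := tailFam M L n P T (by omega)) (by simp))
    (zOf M L 0 0 fun _ => NN n P + 1 + j) (zOf_mem M hh _ _ _) ?_ _ (by simp) fun k hk => ⟨_, List.mem_singleton.2 rfl, ?_⟩
  · rw [eval_tailGuard M hinj hh _ hj hS]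
    exact one_ne_zero
  · rw [ptVar_blk M hJ, readAddr_const_var]

include hinj hh hT hY in
/-- **The top families force the top move clauses** (`t < T`). [cite: Sipser2012, Thm. 7.37 (φ_move)] -/
theorem holds_top {t : ℕ} (ht : t < T) (a : Fin (3 * d + 1) → Val M.tm) (r : Fin (2 * d + 1)) :
    HClause.Holds (τOf M L x P T Y)
      ((List.finRange (3 * d + 1)).map fun s : Fin (3 * d + 1) => (β t s, a s), [(β (t + 1) r, topF d a r)]) := by
  have hS1 : SS = NN n P + d * T + 3 * d := rfl
  refine holds_of_family M hY _ _ _ _ (mem_nFams_top M a r)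
    (zOf M L t (t + 1) fun _ => 0) (zOf_mem M hh _ _ _) ?_ _ (fun k hk => ?_) fun k hk => ?_
  · rw [eval_stepGuard M hinj hh _ _ ht hT]
    exact one_ne_zero
  · obtain ⟨s, -, rfl⟩ := List.mem_map.1 hk
    refine ⟨(β t s, a s), List.mem_map.2 ⟨s, List.mem_finRange s, rfl⟩, ?_⟩
    rw [ptVar_blk M (by have := s.2; omega), Fin.lastCases_castSucc, readAddr_var_const]
  · simp only [List.mem_cons, List.mem_nil_iff, or_false] at hk
    subst hk
    refine ⟨_, List.mem_singleton.2 rfl, ?_⟩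
    rw [ptVar_blk M (by have := r.2; omega), Fin.lastCases_last, readAddr_var'_const]

include hinj hh hT hS hY in
/-- **The interior families force the interior move clauses** (`t < T`, `j < NN + dT`).
[cite: Sipser2012, Thm. 7.37 (φ_move)] -/
theorem holds_int {t j : ℕ} (ht : t < T) (hj : j < NN n P + d * T) (hd' : Fin (d + 1) → Val M.tm) (nb : Fin (2 * d + 1) → Val M.tm) :
    HClause.Holds (τOf M L x P T Y)
      (((List.finRange (d + 1)).map fun s : Fin (d + 1) => (β t s, hd' s)) ++
          ((List.finRange (2 * d + 1)).map fun s : Fin (2 * d + 1) => (β t (d + 1 + j + s), nb s)),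
        [(β (t + 1) (2 * d + 1 + j), intF d hd' nb)]) := by
  have hS1 : SS = NN n P + d * T + 3 * d := rfl
  refine holds_of_family M hY _ _ _ _ (mem_nFams_int M hd' nb)
    (zOf M L t (t + 1) fun s : Fin (2 * d + 1) => d + 1 + j + s) (zOf_mem M hh _ _ _) ?_ _ (fun k hk => ?_) fun k hk => ?_
  · rw [eval_intGuard M hinj hh _ ht hT hj hS]
    exact one_ne_zero
  · rcases List.mem_append.1 hk with hk | hk
    · obtain ⟨s, -, rfl⟩ := List.mem_map.1 hk
      refine ⟨(β t s, hd' s), List.mem_append_left _ (List.mem_map.2 ⟨s, List.mem_finRange s, rfl⟩), ?_⟩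
      rw [ptVar_blk M (by have := s.2; omega), Fin.lastCases_castSucc, Fin.addCases_left, readAddr_var_const]
    · obtain ⟨s, -, rfl⟩ := List.mem_map.1 hk
      refine ⟨(β t (d + 1 + j + s), nb s), List.mem_append_right _ (List.mem_map.2 ⟨s, List.mem_finRange s, rfl⟩), ?_⟩
      rw [ptVar_blk M (by have := s.2; omega), Fin.lastCases_castSucc, Fin.addCases_right, readAddr_var_var]
  · simp only [List.mem_cons, List.mem_nil_iff, or_false] at hk
    subst hk
    refine ⟨_, List.mem_singleton.2 rfl, ?_⟩
    rw [ptVar_blk M (by omega), Fin.lastCases_last, readAddr_var'_var]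
    congr 1
    simp only
    omega

include hinj hh hT hY in
/-- **The bottom families force the empty bottom** (`t < T`, `r < d`). [cite: Sipser2012, Thm. 7.37] -/
theorem holds_bot {t r : ℕ} (ht : t < T) (hr : r < d) :
    HClause.Holds (τOf M L x P T Y) ([], [(β (t + 1) (NN n P + d * T + 2 * d + 1 + r), noneVal M.tm)]) := by
  have hS1 : SS = NN n P + d * T + 3 * d := rfl
  refine holds_of_family M hY _ [] [0] _ (mem_nFams_bot M hr)
    (zOf M L t (t + 1) fun _ => 0) (zOf_mem M hh _ _ _) ?_ _ (by simp) fun k hk => ⟨_, List.mem_singleton.2 rfl, ?_⟩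
  · rw [eval_stepGuard M hinj hh _ _ ht hT]
    exact one_ne_zero
  · rw [ptVar_blk M (by omega), readAddr_var'_const]

include hinj hh hT hS hY in
/-- **The block families force the exactly-one clauses** (`t ≤ T`, `J ≤ S₁`). [cite: Sipser2012, Thm. 7.37 (φ_cell)] -/
theorem holds_cell {t J : ℕ} (ht : t ≤ T) (hJ : J ≤ SS) :
    HClause.Holds (τOf M L x P T Y) ([], (allVals M).map fun v => (β t J, v)) ∧
    ∀ v v' : Val M.tm, v ≠ v' → HClause.Holds (τOf M L x P T Y) ([(β t J, v), (β t J, v')], []) := by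
  constructor
  · refine holds_of_family M hY _ [] _ _ (mem_nFams_head M (φ := cellAnyFam M L n P T) (by simp))
      (zOf M L t 0 fun _ => J) (zOf_mem M hh _ _ _) ?_ _ (by simp) fun k hk => ⟨(β t J, valOf M k), List.mem_map.2 ⟨_, mem_allVals M _, rfl⟩, ?_⟩
    · rw [eval_cellGuard M hinj hh _ ht hT (by exact hJ) hS]
      exact one_ne_zero
    · rw [ptVar_blk M hJ, readAddr_var_var]
  · intro v v' hvv
    refine holds_of_family M hY _ [0, 1] [] _ (mem_nFams_pair M hvv)
      (zOf M L t 0 fun _ => J) (zOf_mem M hh _ _ _) ?_ _ (fun k hk => ?_) (by simp)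
    · rw [eval_cellGuard M hinj hh _ ht hT (by exact hJ) hS]
      exact one_ne_zero
    · simp only [List.mem_cons, List.mem_nil_iff, or_false] at hk
      rcases hk with rfl | rfl
      · exact ⟨(β t J, v), by simp, by rw [ptVar_blk M hJ, readAddr_var_var]; rfl⟩
      · exact ⟨(β t J, v'), by simp, by rw [ptVar_blk M hJ, readAddr_var_var]; rfl⟩

include hinj hh hT hS hY in
/-- **Decoding**: if the oracle `Y` satisfies the arithmetized tableau CSP on `H^m`, `H = {0,…,h-1}`
(with `h` injective in `F`, `T < h^{kt}`, `S₁ < h^{kJ}`), then the decoded assignment satisfies every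
Cook–Levin clause. [cite: BabaiFortnowLund1991, §4 (arithmetization of 3SAT/tableaux)]
[cite: Sipser2012, Thm. 7.37] -/
theorem holds_of_satisfies : ∀ cl ∈ Tableau.clauses M P T x, HClause.Holds (τOf M L x P T Y) cl := by
  have hS1 : SS = NN n P + d * T + 3 * d := rfl
  have hN : NN n P = 2 * n + 2 + P := rfl
  have hd1 : 1 ≤ d := by unfold dM; omega
  intro cl hcl
  unfold clauses xClauses nClauses at hcl
  simp only [List.mem_append, List.mem_flatMap, List.mem_range, List.mem_cons, List.mem_nil_iff, or_false] at hcl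
  rcases hcl with ⟨⟨b, i⟩, hbi, hcl⟩ | (((hcl | ⟨t, ht, hcl⟩) | ⟨t, ht, J, hJ, hcl⟩) | rfl)
  · -- bits of `x`
    have hb : x[i]? = some b := List.mk_mem_zipIdx_iff_getElem?.1 hbi
    have hi : i < n := by
      by_contra hle; rw [List.getElem?_eq_none (by omega)] at hb; cases hb
    simp only [bitClauses, List.mem_cons, List.mem_nil_iff, or_false] at hcl
    rcases hcl with rfl | rfl
    · exact holds_unit' M hh hY (by omega) (mem_xFams_bit M hbi (by simp))
    · exact holds_unit' M hh hY (by omega) (mem_xFams_bit M hbi (by simp))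
  · -- start row
    simp only [startClauses, List.mem_append, List.mem_cons, List.mem_nil_iff, or_false, List.mem_flatMap, List.mem_range,
      List.mem_map] at hcl
    rcases hcl with ((rfl | rfl | rfl) | ⟨j, hj, hcl⟩) | ⟨j, hj, rfl⟩
    · exact holds_unit' M hh hY (by omega) (mem_nFams_head M (by simp))
    · exact holds_unit' M hh hY (by omega) (mem_nFams_head M (by simp))
    · exact holds_unit' M hh hY (by omega) (mem_nFams_head M (by simp))
    · rcases hcl with rfl | rfl
      · exact (holds_cert M hh hY hj).1
      · exact (holds_cert M hh hY hj).2
    · exact holds_tail M hinj hh hS hY hj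
  · -- move clauses of row `t < T`
    simp only [topClauses, intClauses, botClauses, List.mem_flatMap, List.mem_map, List.mem_range] at hcl
    rcases hcl with (⟨a, -, r, -, rfl⟩ | ⟨j, hj, h, -, nb, -, rfl⟩) | ⟨r, hr, rfl⟩
    · exact holds_top M hinj hh hT hY ht a r
    · exact holds_int M hinj hh hT hS hY ht hj h nb
    · exact holds_bot M hinj hh hT hY ht hr
  · -- exactly-one clauses
    simp only [cellClauses, List.mem_cons, List.mem_flatMap] at hcl
    rcases hcl with rfl | ⟨v, -, v', -, hcl⟩
    · exact (holds_cell M hinj hh hT hS hY (by omega) (by omega)).1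
    · by_cases hvv : v = v'
      · rw [if_pos hvv] at hcl; simp at hcl
      · rw [if_neg hvv] at hcl
        simp only [List.mem_singleton] at hcl
        subst hcl
        exact (holds_cell M hinj hh hT hS hY (by omega) (by omega)).2 v v' hvv
  · -- accept
    exact holds_unit' M hh hY (by omega) (mem_nFams_head M (by simp))

end Shapes

end ToClauses

/-! ### From the clauses to the CSP: encoding a satisfying assignment -/

section FromClauses

variable {x : List Bool} {P T : ℕ}
  (hinj : ∀ a b : ℕ, a < L.h → b < L.h → (a : F) = b → a = b) (hh : 0 < L.h) (hval : Nat.card (Val M.tm) ≤ L.h)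
  (hT : T < L.h ^ L.kt) (hS : S1 M x.length P T < L.h ^ L.kJ)
  (τ : TVar M → Bool)

local notation "d" => dM M
local notation "n" => x.length
local notation "β" => blk M (List.length x) P T
local notation "SS" => S1 M (List.length x) P T

include hh in
/-- Every `H`-index is a digit index `zOf t t' cols`. [folklore] -/
theorem exists_eq_zOf {z : Fin (KIdx L d) → F} (hz : ∀ q, z q ∈ nodes (F := F) L.h) :
    ∃ (t t' : ℕ) (cols : Fin (2 * d + 1) → ℕ), t < L.h ^ L.kt ∧ t' < L.h ^ L.kt ∧ (∀ c, cols c < L.h ^ L.kJ) ∧ z = zOf M L t t' cols := by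
  classical
  have hdig : ∀ q, ∃ a : ℕ, a < L.h ∧ (a : F) = z q := fun q => by
    obtain ⟨a, ha, hq⟩ := mem_image.1 (hz q)
    exact ⟨a, mem_range.1 ha, hq⟩
  choose dig hdig_lt hdig_eq using hdig
  refine ⟨dval L.h fun i => dig (tSlot i), dval L.h fun i => dig (t'Slot i), fun c => dval L.h fun i => dig (cSlot c i),
    dval_lt _ _ fun i => hdig_lt _, dval_lt _ _ fun i => hdig_lt _, fun c => dval_lt _ _ fun i => hdig_lt _, funext fun q => ?_⟩
  rw [← (idxEquiv L d).apply_symm_apply q]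
  rcases (idxEquiv L d).symm q with (i | i) | ⟨c, i⟩
  · rw [← hdig_eq]
    show (dig (tSlot i) : F) = zOf M L _ _ _ (tSlot i)
    rw [zOf_tSlot, digitsOf_dval hh fun i => hdig_lt _]
  · rw [← hdig_eq]
    show (dig (t'Slot i) : F) = zOf M L _ _ _ (t'Slot i)
    rw [zOf_t'Slot, digitsOf_dval hh fun i => hdig_lt _]
  · rw [← hdig_eq]
    show (dig (cSlot c i) : F) = zOf M L _ _ _ (cSlot c i)
    rw [zOf_cSlot, digitsOf_dval hh fun i => hdig_lt _]

omit [DecidableEq F] in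
include hinj hh hval in
/-- **Points of blocks are distinct** (rows `< h^{kt}`, columns `< h^{kJ}`, `|Val| ≤ h`). [folklore] -/
theorem ptOf_inj {t t' J J' : ℕ} (ht : t < L.h ^ L.kt) (ht' : t' < L.h ^ L.kt) (hJ : J < L.h ^ L.kJ) (hJ' : J' < L.h ^ L.kJ)
    {v v' : Val M.tm} (e : (ptOf M L t J v : Fin (mPt L) → F) = ptOf M L t' J' v') : t = t' ∧ J = J' ∧ v = v' := by
  obtain ⟨e1, e2, e3⟩ := mkPt_inj e
  have hdt : digitsOf L.h (k := L.kt) t = digitsOf L.h t' := funext fun i =>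
    hinj _ _ (digitsOf_lt hh _ _) (digitsOf_lt hh _ _) (congrFun e1 i)
  have hdJ : digitsOf L.h (k := L.kJ) J = digitsOf L.h J' := funext fun i =>
    hinj _ _ (digitsOf_lt hh _ _) (digitsOf_lt hh _ _) (congrFun e2 i)
  refine ⟨?_, ?_, vcode_injective M (hinj _ _ ((vcode_lt M v).trans_le hval) ((vcode_lt M v').trans_le hval) e3)⟩
  · rw [← dval_digitsOf hh ht, ← dval_digitsOf hh ht', hdt]
  · rw [← dval_digitsOf hh hJ, ← dval_digitsOf hh hJ', hdJ]

open scoped Classical in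
/-- **The encoded oracle** of an assignment: `1`/`0` at the point of an in-range block literal
according to `τ`, `0` elsewhere. [cite: BabaiFortnowLund1991, §4] -/
def Y0 (L : Layout) (x : List Bool) (P T : ℕ) (τ : TVar M → Bool) : (Fin (mPt L) → F) → F := fun pt =>
  if hq : ∃ q : ℕ × ℕ × Val M.tm, q.1 ≤ T ∧ q.2.1 ≤ S1 M x.length P T ∧ (ptOf M L q.1 q.2.1 q.2.2 : Fin (mPt L) → F) = pt then
    if τ (blk M x.length P T hq.choose.1 hq.choose.2.1, hq.choose.2.2) = true then 1 else 0
  else 0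

omit [DecidableEq F] in
/-- The encoded oracle is `0/1`-valued. [folklore] -/
theorem Y0_zero_or_one (pt : Fin (mPt L) → F) : (Y0 M L x P T τ pt : F) = 0 ∨ Y0 M L x P T τ pt = 1 := by
  unfold Y0
  split_ifs <;> simp

omit [DecidableEq F] in
include hinj hh hval hT hS in
/-- The encoded oracle at the point of an in-range literal. [folklore] -/
theorem Y0_ptOf {t J : ℕ} (ht : t ≤ T) (hJ : J ≤ SS) (v : Val M.tm) :
    (Y0 M L x P T τ (ptOf M L t J v) : F) = if τ (β t J, v) = true then 1 else 0 := by
  have hq : ∃ q : ℕ × ℕ × Val M.tm, q.1 ≤ T ∧ q.2.1 ≤ SS ∧ (ptOf M L q.1 q.2.1 q.2.2 : Fin (mPt L) → F) = ptOf M L t J v :=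
    ⟨(t, J, v), ht, hJ, rfl⟩
  unfold Y0
  rw [dif_pos hq]
  obtain ⟨h1, h2, h3⟩ := hq.choose_spec
  obtain ⟨e1, e2, e3⟩ := ptOf_inj M hinj hh hval (by omega) (by omega) (by omega) (by omega) h3
  rw [e1, e2, e3]

omit [DecidableEq F] in
/-- **A satisfied clause kills the clause product**: if the reads are `0/1`, every premise literal
is realized by a premise read and every conclusion literal by a conclusion read, then
`∏ (premise reads) · ∏ (1 - conclusion reads) = 0`. [folklore] -/
theorem prod_eq_zero_of_holds {cl : HClause (TVar M)} (hcl : cl.Holds τ) {ι : Type} (val : ι → F) (prem concl : List ι)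
    (h01 : ∀ j ∈ prem, val j = 0 ∨ val j = 1)
    (hprem : ∀ w ∈ cl.1, ∃ j ∈ prem, val j = if τ w = true then 1 else 0)
    (hconcl : ∀ w ∈ cl.2, ∃ j ∈ concl, val j = if τ w = true then 1 else 0) :
    (prem.map val).prod * (concl.map fun j => 1 - val j).prod = 0 := by
  by_cases hall : ∀ j ∈ prem, val j = 1
  · have hτ : ∀ w ∈ cl.1, τ w = true := by
      intro w hw
      obtain ⟨j, hj, hvj⟩ := hprem w hw
      by_contra hne
      rw [if_neg hne, hall j hj] at hvj
      exact one_ne_zero hvj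
    obtain ⟨w', hw', hτw'⟩ := hcl hτ
    obtain ⟨j, hj, hvj⟩ := hconcl w' hw'
    rw [if_pos hτw'] at hvj
    have h0 : (concl.map fun j => 1 - val j).prod = 0 :=
      List.prod_eq_zero (List.mem_map.2 ⟨j, hj, by rw [hvj, sub_self]⟩)
    rw [h0, mul_zero]
  · push Not at hall
    obtain ⟨j, hj, hvj⟩ := hall
    have hv0 : val j = 0 := (h01 j hj).resolve_right hvj
    have h0 : (prem.map val).prod = 0 := List.prod_eq_zero (List.mem_map.2 ⟨j, hj, hv0⟩)
    rw [h0, zero_mul]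

/-- The index of a value. [folklore] -/
def vIdx (v : Val M.tm) : Fin (Nat.card (Val M.tm)) := ⟨vcode M v, vcode_lt M v⟩

/-- `valOf` inverts `vIdx`. [folklore] -/
theorem valOf_vIdx (v : Val M.tm) : valOf M (vIdx M v) = v := by
  letI := Fintype.ofFinite (Val M.tm)
  unfold valOf vIdx vcode
  simp

/-! #### The families vanish on the encoded oracle -/

local notation "YY" => Y0 (F := F) M L x P T τ
local notation "CL" => Tableau.clauses M P T x

omit [DecidableEq F] in
/-- A family with vanishing guard vanishes. [folklore] -/
theorem eval_eq_zero_of_guard {r : ℕ} (G : MvPolynomial (Fin (KIdx L d) ⊕ Fin r) F) (prem concl : List (Fin r))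
    (addr : Fin r → Fin (mPt L) → Fin (KIdx L d) ⊕ F) (Yy : (Fin (mPt L) → F) → F) (z : Fin (KIdx L d) → F)
    (hG : MvPolynomial.eval (Sum.elim z fun j => Yy (readAddr (addr j) z)) G = 0) :
    (⟨r, addr, G * clausePoly prem concl⟩ : Family F (KIdx L d) (mPt L)).eval Yy z = 0 := by
  rw [eval_guard_clause, hG, zero_mul]

omit [DecidableEq F] in
/-- **A family reading a satisfied clause vanishes on the encoded oracle.** [cite: BabaiFortnowLund1991, §4] -/
theorem eval_eq_zero_of_clause {r : ℕ} (G : MvPolynomial (Fin (KIdx L d) ⊕ Fin r) F) (prem concl : List (Fin r))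
    (addr : Fin r → Fin (mPt L) → Fin (KIdx L d) ⊕ F) (z : Fin (KIdx L d) → F) {cl : HClause (TVar M)} (hcl : cl.Holds τ)
    (hprem : ∀ w ∈ cl.1, ∃ j ∈ prem, Y0 M L x P T τ (readAddr (addr j) z) = if τ w = true then 1 else 0)
    (hconcl : ∀ w ∈ cl.2, ∃ j ∈ concl, Y0 M L x P T τ (readAddr (addr j) z) = if τ w = true then 1 else 0) :
    (⟨r, addr, G * clausePoly prem concl⟩ : Family F (KIdx L d) (mPt L)).eval YY z = 0 := by
  rw [eval_guard_clause, prod_eq_zero_of_holds M τ hcl (fun j => Y0 M L x P T τ (readAddr (addr j) z)) prem concl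
    (fun j _ => Y0_zero_or_one M τ _) hprem hconcl, mul_zero]

section Vanish

variable (hτ : ∀ cl ∈ Tableau.clauses M P T x, HClause.Holds τ cl) {t t' : ℕ} {cols : Fin (2 * dM M + 1) → ℕ}
  (ht : t < L.h ^ L.kt) (ht' : t' < L.h ^ L.kt) (hcols : ∀ c, cols c < L.h ^ L.kJ)

include hinj hh hval hT hS hτ

omit [DecidableEq F] in
/-- Unit families of clauses vanish. [folklore] -/
theorem eval_unitFam {t0 J0 : ℕ} (ht0 : t0 ≤ T) (hJ0 : J0 ≤ SS) {v : Val M.tm} (hcl : ([], [(β t0 J0, v)]) ∈ CL)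
    (z : Fin (KIdx L d) → F) : (unitFam M L t0 J0 v).eval YY z = 0 := by
  unfold unitFam
  refine eval_eq_zero_of_clause M τ _ _ _ _ z (hτ _ hcl) (by simp) fun w hw => ⟨0, by simp, ?_⟩
  simp only [List.mem_cons, List.mem_nil_iff, or_false] at hw
  subst hw
  rw [readAddr_const_const, Y0_ptOf M hinj hh hval hT hS τ ht0 hJ0]

include hcols in
/-- The tail family vanishes. [folklore] -/
theorem eval_tailFam (hd0 : 0 < 2 * d + 1) : (tailFam M L n P T hd0).eval YY (zOf M L t t' cols) = 0 := by
  have hS1 : SS = NN n P + d * T + 3 * d := rfl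
  unfold tailFam
  by_cases hc : ¬ cols ⟨0, hd0⟩ < NN n P + 1 ∧ cols ⟨0, hd0⟩ < SS + 1
  · obtain ⟨j, hj, hje⟩ : ∃ j, j < d * T + 3 * d ∧ cols ⟨0, hd0⟩ = NN n P + 1 + j := ⟨cols ⟨0, hd0⟩ - (NN n P + 1), by omega, by omega⟩
    have hcl : ([], [(β 0 (NN n P + 1 + j), noneVal M.tm)]) ∈ CL :=
      Tableau.mem_clauses_start (M := M) (x := x) (P := P) (T := T) (by
        unfold startClauses
        exact List.mem_append_right _ (List.mem_map.2 ⟨j, List.mem_range.2 hj, rfl⟩))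
    refine eval_eq_zero_of_clause M τ _ _ _ _ _ (hτ _ hcl) (by simp) fun w hw => ⟨0, by simp, ?_⟩
    simp only [List.mem_cons, List.mem_nil_iff, or_false] at hw
    subst hw
    rw [readAddr_const_var, hje, Y0_ptOf M hinj hh hval hT hS τ (t := 0) (J := NN n P + 1 + j) (by omega) (by omega)]
  · refine eval_eq_zero_of_guard M _ _ _ _ _ _ ?_
    rw [eval_tailGuard_if M hinj hh _ cols hd0 (hcols _), if_neg hc]

omit [DecidableEq F] in
/-- The certificate families vanish (`j < P`). [folklore] -/
theorem eval_certFam {j : ℕ} (hj : j < P) (z : Fin (KIdx L d) → F) :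
    (certAnyFam M L n j).eval YY z = 0 ∧ (certNextFam M L n j).eval YY z = 0 := by
  have hS1 : SS = NN n P + d * T + 3 * d := rfl
  have hN : NN n P = 2 * n + 2 + P := rfl
  have hd1 : 1 ≤ d := by unfold dM; omega
  have hc : 2 * n + 3 + j ≤ SS := by omega
  have hc' : 2 * n + 4 + j ≤ SS := by nlinarith
  have hmem : ∀ cl, cl ∈ [([], [(β 0 (2 * n + 3 + j), symVal M false), (β 0 (2 * n + 3 + j), symVal M true),
        (β 0 (2 * n + 3 + j), noneVal M.tm)]),
      ([(β 0 (2 * n + 3 + j), noneVal M.tm)], [(β 0 (2 * n + 4 + j), noneVal M.tm)])] → cl ∈ CL := fun cl hcl' =>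
    Tableau.mem_clauses_start (M := M) (x := x) (P := P) (T := T) (by
      unfold startClauses
      exact List.mem_append_left _ (List.mem_append_right _ (List.mem_flatMap.2 ⟨j, List.mem_range.2 hj, hcl'⟩)))
  have hcl1 := hmem ([], [(β 0 (2 * n + 3 + j), symVal M false), (β 0 (2 * n + 3 + j), symVal M true),
    (β 0 (2 * n + 3 + j), noneVal M.tm)]) (by simp)
  have hcl2 := hmem ([(β 0 (2 * n + 3 + j), noneVal M.tm)], [(β 0 (2 * n + 4 + j), noneVal M.tm)]) (by simp)
  constructor
  · unfold certAnyFam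
    refine eval_eq_zero_of_clause M τ _ _ _ _ z (hτ _ hcl1) (by simp) fun w hw => ?_
    simp only [List.mem_cons, List.mem_nil_iff, or_false] at hw
    rcases hw with rfl | rfl | rfl
    · exact ⟨0, by simp, by rw [readAddr_const_const, Y0_ptOf M hinj hh hval hT hS τ (t := 0) (Nat.zero_le _) hc]; rfl⟩
    · exact ⟨1, by simp, by rw [readAddr_const_const, Y0_ptOf M hinj hh hval hT hS τ (t := 0) (Nat.zero_le _) hc]; rfl⟩
    · exact ⟨2, by simp, by rw [readAddr_const_const, Y0_ptOf M hinj hh hval hT hS τ (t := 0) (Nat.zero_le _) hc]; rfl⟩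
  · unfold certNextFam
    refine eval_eq_zero_of_clause M τ _ _ _ _ z (hτ _ hcl2) (fun w hw => ?_) fun w hw => ?_
    · simp only [List.mem_cons, List.mem_nil_iff, or_false] at hw
      subst hw
      refine ⟨0, by simp, ?_⟩
      rw [readAddr_const_const, Fin.val_zero, add_zero, Y0_ptOf M hinj hh hval hT hS τ (t := 0) (Nat.zero_le _) hc]
    · simp only [List.mem_cons, List.mem_nil_iff, or_false] at hw
      subst hw
      refine ⟨1, by simp, ?_⟩
      rw [readAddr_const_const, Fin.val_one, show 2 * n + 3 + j + 1 = 2 * n + 4 + j by omega,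
        Y0_ptOf M hinj hh hval hT hS τ (t := 0) (Nat.zero_le _) hc']

include ht ht' in
/-- The top families vanish. [folklore] -/
theorem eval_topFam (a : Fin (3 * d + 1) → Val M.tm) (r : Fin (2 * d + 1)) : (topFam M L T a r).eval YY (zOf M L t t' cols) = 0 := by
  have hS1 : SS = NN n P + d * T + 3 * d := rfl
  unfold topFam
  by_cases hst : t < T ∧ t' = t + 1
  · obtain ⟨htT, rfl⟩ := hst
    have hcl : (((List.finRange (3 * d + 1)).map fun s : Fin (3 * d + 1) => (β t s, a s)), [(β (t + 1) r, topF d a r)]) ∈ CL :=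
      Tableau.mem_clauses_top (M := M) (x := x) (P := P) (T := T) htT
        (List.mem_flatMap.2 ⟨a, mem_allTuples M a, List.mem_map.2 ⟨r, List.mem_finRange r, rfl⟩⟩)
    refine eval_eq_zero_of_clause M τ _ _ _ _ _ (hτ _ hcl) (fun w hw => ?_) fun w hw => ?_
    · obtain ⟨s, -, rfl⟩ := List.mem_map.1 hw
      refine ⟨Fin.castSucc s, List.mem_map.2 ⟨s, List.mem_finRange s, rfl⟩, ?_⟩
      rw [Fin.lastCases_castSucc, readAddr_var_const,
        Y0_ptOf M hinj hh hval hT hS τ (t := t) (J := s) (by omega) (by have := s.2; omega)]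
    · simp only [List.mem_cons, List.mem_nil_iff, or_false] at hw
      subst hw
      refine ⟨Fin.last _, by simp, ?_⟩
      rw [Fin.lastCases_last, readAddr_var'_const,
        Y0_ptOf M hinj hh hval hT hS τ (t := t + 1) (J := r) (by omega) (by have := r.2; omega)]
  · refine eval_eq_zero_of_guard M _ _ _ _ _ _ ?_
    rw [eval_stepGuard_if M hinj hh _ cols ht ht', if_neg hst]

include ht ht' hcols in
/-- The interior families vanish. [folklore] -/
theorem eval_intFam (hd' : Fin (d + 1) → Val M.tm) (nb : Fin (2 * d + 1) → Val M.tm) :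
    (intFam M L n P T hd' nb).eval YY (zOf M L t t' cols) = 0 := by
  have hS1 : SS = NN n P + d * T + 3 * d := rfl
  unfold intFam
  rcases eval_intGuard_eq_zero_or M (List.length x) P T hinj hh
      (fun j => Y0 M L x P T τ (readAddr (@Fin.lastCases ((d + 1) + (2 * d + 1)) (fun _ => Fin (mPt L) → Fin (KIdx L d) ⊕ F)
        (mkAddr (varDig t'Slot) (varDig (cSlot ⟨d, by omega⟩)) (vcode M (intF d hd' nb)))
        (@Fin.addCases (d + 1) (2 * d + 1) (fun _ => Fin (mPt L) → Fin (KIdx L d) ⊕ F)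
          (fun s => mkAddr (varDig tSlot) (constDig L.h s) (vcode M (hd' s)))
          (fun s => mkAddr (varDig tSlot) (varDig (cSlot s)) (vcode M (nb s)))) j) (zOf M L t t' cols)))
      cols ht ht' hcols with h0 | ⟨htT, rfl, hsucc, h3, h4⟩
  · exact eval_eq_zero_of_guard M _ _ _ _ _ _ h0
  · -- the columns are consecutive
    have hcol : ∀ (k : ℕ) (hk : k < 2 * d + 1), cols ⟨k, hk⟩ = cols ⟨0, by omega⟩ + k := by
      intro k
      induction k with
      | zero => intro hk; rfl
      | succ k ih =>
        intro hk
        have := hsucc ⟨k, by omega⟩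
        simp only [Fin.succ_mk, Fin.castSucc_mk] at this
        rw [this, ih (by omega)]
        omega
    obtain ⟨j, hj, hje⟩ : ∃ j, j < NN n P + d * T ∧ cols ⟨0, by omega⟩ = d + 1 + j := ⟨cols ⟨0, by omega⟩ - (d + 1), by omega, by omega⟩
    have hcolj : ∀ s : Fin (2 * d + 1), cols s = d + 1 + j + s := fun s => by rw [show s = ⟨s.1, s.2⟩ from rfl, hcol s.1 s.2, hje]
    have hcl : ((((List.finRange (d + 1)).map fun s : Fin (d + 1) => (β t s, hd' s)) ++
          ((List.finRange (2 * d + 1)).map fun s : Fin (2 * d + 1) => (β t (d + 1 + j + s), nb s)),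
        [(β (t + 1) (2 * d + 1 + j), intF d hd' nb)]) : HClause (TVar M)) ∈ CL :=
      Tableau.mem_clauses_int (M := M) (x := x) (P := P) (T := T) htT hj
        (List.mem_flatMap.2 ⟨hd', mem_allTuples M hd', List.mem_map.2 ⟨nb, mem_allTuples M nb, rfl⟩⟩)
    refine eval_eq_zero_of_clause M τ _ _ _ _ _ (hτ _ hcl) (fun w hw => ?_) fun w hw => ?_
    · rcases List.mem_append.1 hw with hw | hw
      · obtain ⟨s, -, rfl⟩ := List.mem_map.1 hw
        refine ⟨Fin.castSucc (Fin.castAdd (2 * d + 1) s), List.mem_append_left _ (List.mem_map.2 ⟨s, List.mem_finRange s, rfl⟩), ?_⟩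
        rw [Fin.lastCases_castSucc, Fin.addCases_left, readAddr_var_const,
          Y0_ptOf M hinj hh hval hT hS τ (t := t) (J := s) (by omega) (by have := s.2; omega)]
      · obtain ⟨s, -, rfl⟩ := List.mem_map.1 hw
        refine ⟨Fin.castSucc (Fin.natAdd (d + 1) s), List.mem_append_right _ (List.mem_map.2 ⟨s, List.mem_finRange s, rfl⟩), ?_⟩
        rw [Fin.lastCases_castSucc, Fin.addCases_right, readAddr_var_var, hcolj s,
          Y0_ptOf M hinj hh hval hT hS τ (t := t) (J := d + 1 + j + s) (by omega) (by have := s.2; omega)]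
    · simp only [List.mem_cons, List.mem_nil_iff, or_false] at hw
      subst hw
      refine ⟨Fin.last _, by simp, ?_⟩
      have hcd : cols ⟨d, by omega⟩ = 2 * d + 1 + j := by rw [hcol d (by omega)]; omega
      rw [Fin.lastCases_last, readAddr_var'_var, hcd,
        Y0_ptOf M hinj hh hval hT hS τ (t := t + 1) (J := 2 * d + 1 + j) (by omega) (by omega)]

include ht ht' in
/-- The bottom families vanish (`r < d`). [folklore] -/
theorem eval_botFam {r : ℕ} (hr : r < d) : (botFam M L n P T r).eval YY (zOf M L t t' cols) = 0 := by
  have hS1 : SS = NN n P + d * T + 3 * d := rfl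
  unfold botFam
  by_cases hst : t < T ∧ t' = t + 1
  · obtain ⟨htT, rfl⟩ := hst
    have hcl : ([], [(β (t + 1) (NN n P + d * T + 2 * d + 1 + r), noneVal M.tm)]) ∈ CL :=
      Tableau.mem_clauses_bot (M := M) (x := x) (P := P) (T := T) htT (List.mem_map.2 ⟨r, List.mem_range.2 hr, rfl⟩)
    refine eval_eq_zero_of_clause M τ _ _ _ _ _ (hτ _ hcl) (by simp) fun w hw => ⟨0, by simp, ?_⟩
    simp only [List.mem_cons, List.mem_nil_iff, or_false] at hw
    subst hw
    rw [readAddr_var'_const, Y0_ptOf M hinj hh hval hT hS τ (t := t + 1) (J := NN n P + d * T + 2 * d + 1 + r) (by omega) (by omega)]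
  · refine eval_eq_zero_of_guard M _ _ _ _ _ _ ?_
    rw [eval_stepGuard_if M hinj hh _ cols ht ht', if_neg hst]

include ht hcols in
/-- The block families vanish. [folklore] -/
theorem eval_cellFam : (cellAnyFam M L n P T).eval YY (zOf M L t t' cols) = 0 ∧
    ∀ v v' : Val M.tm, v ≠ v' → (cellPairFam M L n P T v v').eval YY (zOf M L t t' cols) = 0 := by
  by_cases hg : t < T + 1 ∧ cols ⟨0, by omega⟩ < SS + 1
  · obtain ⟨htT, hJ⟩ := hg
    constructor
    · unfold cellAnyFam
      have hcl : (([], (allVals M).map fun v => (β t (cols ⟨0, by omega⟩), v)) : HClause (TVar M)) ∈ CL :=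
        Tableau.mem_clauses_cell (M := M) (x := x) (P := P) (T := T) (t := t) (J := cols ⟨0, by omega⟩) (by omega) (by omega)
          (by unfold cellClauses; exact List.mem_cons_self)
      refine eval_eq_zero_of_clause M τ _ _ _ _ _ (hτ _ hcl) (by simp) fun w hw => ?_
      obtain ⟨v, -, rfl⟩ := List.mem_map.1 hw
      refine ⟨vIdx M v, List.mem_finRange _, ?_⟩
      rw [readAddr_var_var, valOf_vIdx, Y0_ptOf M hinj hh hval hT hS τ (t := t) (J := cols ⟨0, by omega⟩) (by omega) (by omega)]
    · intro v v' hvv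
      unfold cellPairFam
      have hcl : (([(β t (cols ⟨0, by omega⟩), v), (β t (cols ⟨0, by omega⟩), v')], []) : HClause (TVar M)) ∈ CL := by
        refine Tableau.mem_clauses_cell (M := M) (x := x) (P := P) (T := T) (t := t) (J := cols ⟨0, by omega⟩) (by omega) (by omega) ?_
        unfold cellClauses
        refine List.mem_cons_of_mem _ (List.mem_flatMap.2 ⟨v, mem_allVals M v, List.mem_flatMap.2 ⟨v', mem_allVals M v', ?_⟩⟩)
        rw [if_neg hvv]
        exact List.mem_singleton.2 rfl
      refine eval_eq_zero_of_clause M τ _ _ _ _ _ (hτ _ hcl) (fun w hw => ?_) (by simp)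
      simp only [List.mem_cons, List.mem_nil_iff, or_false] at hw
      rcases hw with rfl | rfl
      · refine ⟨0, by simp, ?_⟩
        rw [readAddr_var_var, Y0_ptOf M hinj hh hval hT hS τ (t := t) (J := cols ⟨0, by omega⟩) (by omega) (by omega)]
        rfl
      · refine ⟨1, by simp, ?_⟩
        rw [readAddr_var_var, Y0_ptOf M hinj hh hval hT hS τ (t := t) (J := cols ⟨0, by omega⟩) (by omega) (by omega)]
        rfl
  · have hG : MvPolynomial.eval (Sum.elim (zOf M L t t' cols) fun j : Fin 0 => (0 : F)) (cellGuard (F := F) (r := 0) M L n P T) = 0 ∨ True := Or.inr trivial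
    constructor
    · unfold cellAnyFam
      refine eval_eq_zero_of_guard M _ _ _ _ _ _ ?_
      rw [eval_cellGuard_if M hinj hh _ cols ht (hcols _), if_neg hg]
    · intro v v' _
      unfold cellPairFam
      refine eval_eq_zero_of_guard M _ _ _ _ _ _ ?_
      rw [eval_cellGuard_if M hinj hh _ cols ht (hcols _), if_neg hg]

end Vanish

include hinj hh hval hT hS in
/-- **Encoding**: if `τ` satisfies every Cook–Levin clause, the encoded oracle satisfies the
arithmetized tableau CSP on `Hᴷ`. [cite: BabaiFortnowLund1991, §4] [cite: Sipser2012, Thm. 7.37] -/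
theorem satisfies_Y0 (hτ : ∀ cl ∈ CL, cl.Holds τ) : (tableauCSP M L P T x).Satisfies (nodes (F := F) L.h) YY := by
  have hS1 : SS = NN n P + d * T + 3 * d := rfl
  have hN : NN n P = 2 * n + 2 + P := rfl
  have hd1 : 1 ≤ d := by unfold dM; omega
  refine ⟨fun i z hz => ?_⟩
  obtain ⟨t, t', cols, ht, ht', hcols, rfl⟩ := exists_eq_zOf M hh hz
  set φ := (tableauCSP M L P T x).fam i with hφdef
  have hφ : φ ∈ xFams M L x ++ nFams M L n P T := (mem_fams_iff M L P T x φ).1 ⟨i, rfl⟩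
  clear_value φ
  rcases List.mem_append.1 hφ with hφ | hφ
  · -- bit families
    unfold xFams at hφ
    obtain ⟨⟨b, i'⟩, hbi, hφ⟩ := List.mem_flatMap.1 hφ
    have hb : x[i']? = some b := List.mk_mem_zipIdx_iff_getElem?.1 hbi
    have hi : i' < n := by
      by_contra hle; rw [List.getElem?_eq_none (by omega)] at hb; cases hb
    simp only [List.mem_cons, List.mem_nil_iff, or_false] at hφ
    rcases hφ with rfl | rfl
    · exact eval_unitFam M hinj hh hval hT hS τ hτ (by omega) (by omega)
        (Tableau.mem_clauses_bit (M := M) (x := x) (P := P) (T := T) hb (by unfold bitClauses; simp)) _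
    · exact eval_unitFam M hinj hh hval hT hS τ hτ (by omega) (by omega)
        (Tableau.mem_clauses_bit (M := M) (x := x) (P := P) (T := T) hb (by unfold bitClauses; simp)) _
  · unfold nFams at hφ
    simp only [List.mem_append, List.mem_cons, List.mem_nil_iff, or_false, List.mem_flatMap, List.mem_map, List.mem_range] at hφ
    rcases hφ with (((((rfl | rfl | rfl | rfl | rfl | rfl) | ⟨j, hj, rfl | rfl⟩) | ⟨a, -, r, -, rfl⟩) | ⟨hd', -, nb, -, rfl⟩) | ⟨r, hr, rfl⟩) | ⟨v, -, v', -, hφ⟩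
    · exact eval_unitFam M hinj hh hval hT hS τ hτ (by omega) (by omega)
        (Tableau.mem_clauses_start (M := M) (x := x) (P := P) (T := T) (by unfold startClauses; simp)) _
    · exact eval_unitFam M hinj hh hval hT hS τ hτ (by omega) (by omega)
        (Tableau.mem_clauses_start (M := M) (x := x) (P := P) (T := T) (by unfold startClauses; simp)) _
    · exact eval_unitFam M hinj hh hval hT hS τ hτ (by omega) (by omega)
        (Tableau.mem_clauses_start (M := M) (x := x) (P := P) (T := T) (by unfold startClauses; simp)) _
    · exact eval_tailFam M hinj hh hval hT hS τ hτ hcols _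
    · exact eval_unitFam M hinj hh hval hT hS τ hτ le_rfl (by omega) (Tableau.mem_clauses_acc (M := M) (x := x) (P := P) (T := T)) _
    · exact (eval_cellFam M hinj hh hval hT hS τ hτ ht hcols).1
    · exact (eval_certFam M hinj hh hval hT hS τ hτ hj _).1
    · exact (eval_certFam M hinj hh hval hT hS τ hτ hj _).2
    · exact eval_topFam M hinj hh hval hT hS τ hτ ht ht' a r
    · exact eval_intFam M hinj hh hval hT hS τ hτ ht ht' hcols hd' nb
    · exact eval_botFam M hinj hh hval hT hS τ hτ ht ht' hr
    · by_cases hvv : v = v'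
      · rw [if_pos hvv] at hφ; simp at hφ
      · rw [if_neg hvv] at hφ
        simp only [List.mem_singleton] at hφ
        subst hφ
        exact (eval_cellFam M hinj hh hval hT hS τ hτ ht hcols).2 v v' hvv

/-! ### The equivalence -/

include hinj hh hval hT hS in
/-- **The arithmetized tableau is satisfiable on `Hᴷ` iff the Cook–Levin clause set is satisfiable.**
[cite: BabaiFortnowLund1991, §4] [cite: Sipser2012, Thm. 7.37] -/
theorem satisfiable_tableauCSP_iff :
    (tableauCSP M L P T x).Satisfiable (nodes (F := F) L.h) ↔ ∃ τ : TVar M → Bool, ∀ cl ∈ CL, cl.Holds τ := by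
  constructor
  · rintro ⟨Y, hY⟩
    exact ⟨τOf M L x P T Y, holds_of_satisfies M hinj hh hT hS hY⟩
  · rintro ⟨τ, hτ⟩
    exact ⟨Y0 M L x P T τ, satisfies_Y0 M hinj hh hval hT hS τ hτ⟩

include hinj hh hval hT hS in
/-- **Correctness of the arithmetized tableau.** If `M` halts within `T` steps with output `[f w]`
on every `w = boolPair x u`, `|u| ≤ P`, then the tableau CSP is satisfiable on `Hᴷ` iff some
certificate `u`, `|u| ≤ P`, has `f (boolPair x u) = true`. [cite: BabaiFortnowLund1991, §4]
[cite: Cook1971, Thm. 1] [cite: Sipser2012, Thm. 7.37] -/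
theorem satisfiable_tableauCSP_iff_exists {f : List Bool → Bool}
    (hrun : ∀ u : List Bool, u.length ≤ P → M.OutputsWithin (boolPair x u) [f (boolPair x u)] T) :
    (tableauCSP M L P T x).Satisfiable (nodes (F := F) L.h) ↔ ∃ u : List Bool, u.length ≤ P ∧ f (boolPair x u) = true := by
  rw [satisfiable_tableauCSP_iff M hinj hh hval hT hS]
  constructor
  · rintro ⟨τ, hτ⟩
    exact Tableau.sound (M := M) hτ hrun
  · rintro ⟨u, hu, hf⟩
    exact ⟨_, Tableau.complete (M := M) hu (hrun u hu) hf⟩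

end FromClauses

/-! ### Well-formedness: the address constants are nodes -/

section WF

variable {x : List Bool} {P T : ℕ} (hh : 0 < L.h) (hval : Nat.card (Val M.tm) ≤ L.h)

local notation "d" => dM M
local notation "n" => x.length

/-- A sourced address whose sources have node constants has node constants. [folklore] -/
theorem mkAddr_const_mem {Kk : ℕ} {ts : Fin L.kt → Fin Kk ⊕ F} {js : Fin L.kJ → Fin Kk ⊕ F} {c0 : F}
    (hts : ∀ i c, ts i = Sum.inr c → c ∈ nodes (F := F) L.h) (hjs : ∀ i c, js i = Sum.inr c → c ∈ nodes (F := F) L.h)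
    (hc0 : c0 ∈ nodes (F := F) L.h) (u : Fin (mPt L)) (c : F) (h : mkAddr ts js c0 u = Sum.inr c) : c ∈ nodes (F := F) L.h := by
  unfold mkAddr at h
  split at h
  · exact hts _ _ h
  · exact hjs _ _ h
  · cases h
    exact hc0

include hh in
/-- Digit constants are nodes. [folklore] -/
theorem constDig_const_mem {k Kk : ℕ} (N : ℕ) (i : Fin k) (c : F) (h : constDig (K := Kk) L.h N i = Sum.inr c) :
    c ∈ nodes (F := F) L.h := by
  unfold constDig at h
  cases h
  exact cast_mem_nodes (digitsOf_lt hh _ _)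

omit [Field F] [DecidableEq F] in
/-- Variable sources have no constants. [folklore] -/
theorem varDig_const_mem {k Kk : ℕ} (slot : Fin k → Fin Kk) (S : Set F) (i : Fin k) (c : F) (h : varDig (F := F) slot i = Sum.inr c) :
    c ∈ S := by
  unfold varDig at h
  cases h

include hval in
/-- Value codes are nodes (`|Val| ≤ h`). [folklore] -/
theorem vcode_mem_nodes (v : Val M.tm) : ((vcode M v : ℕ) : F) ∈ nodes (F := F) L.h :=
  cast_mem_nodes ((vcode_lt M v).trans_le hval)

include hh hval in
/-- An address built from digit constants / digit variables and a value code is well formed. [folklore] -/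
theorem mkAddr_wf {ts : Fin L.kt → Fin (KIdx L d) ⊕ F} {js : Fin L.kJ → Fin (KIdx L d) ⊕ F}
    (hts : (∃ N, ts = constDig L.h N) ∨ ∃ slot, ts = varDig slot) (hjs : (∃ N, js = constDig L.h N) ∨ ∃ slot, js = varDig slot)
    (v : Val M.tm) (u : Fin (mPt L)) (c : F) (h : mkAddr ts js (vcode M v : F) u = Sum.inr c) : c ∈ nodes (F := F) L.h := by
  refine mkAddr_const_mem (fun i c' h' => ?_) (fun i c' h' => ?_) (vcode_mem_nodes M hval v) u c h
  · rcases hts with ⟨N, rfl⟩ | ⟨slot, rfl⟩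
    · exact constDig_const_mem hh N i c' h'
    · exact varDig_const_mem slot _ i c' h'
  · rcases hjs with ⟨N, rfl⟩ | ⟨slot, rfl⟩
    · exact constDig_const_mem hh N i c' h'
    · exact varDig_const_mem slot _ i c' h'

include hh hval in
/-- **Every family of the list is well formed.** [folklore] -/
theorem wf_of_mem {φ : Family F (KIdx L d) (mPt L)} (hφ : φ ∈ xFams M L x ++ nFams M L n P T) : φ.WF (nodes (F := F) L.h) := by
  have cc : ∀ N : ℕ, (∃ N', (constDig L.h N : Fin L.kt → Fin (KIdx L d) ⊕ F) = constDig L.h N') ∨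
      ∃ slot, (constDig L.h N : Fin L.kt → Fin (KIdx L d) ⊕ F) = varDig slot := fun N => Or.inl ⟨N, rfl⟩
  have ccJ : ∀ N : ℕ, (∃ N', (constDig L.h N : Fin L.kJ → Fin (KIdx L d) ⊕ F) = constDig L.h N') ∨
      ∃ slot, (constDig L.h N : Fin L.kJ → Fin (KIdx L d) ⊕ F) = varDig slot := fun N => Or.inl ⟨N, rfl⟩
  have vv : ∀ slot : Fin L.kt → Fin (KIdx L d), (∃ N', (varDig slot : Fin L.kt → Fin (KIdx L d) ⊕ F) = constDig L.h N') ∨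
      ∃ slot', (varDig slot : Fin L.kt → Fin (KIdx L d) ⊕ F) = varDig slot' := fun slot => Or.inr ⟨slot, rfl⟩
  have vvJ : ∀ slot : Fin L.kJ → Fin (KIdx L d), (∃ N', (varDig slot : Fin L.kJ → Fin (KIdx L d) ⊕ F) = constDig L.h N') ∨
      ∃ slot', (varDig slot : Fin L.kJ → Fin (KIdx L d) ⊕ F) = varDig slot' := fun slot => Or.inr ⟨slot, rfl⟩
  rcases List.mem_append.1 hφ with hφ | hφ
  · unfold xFams at hφ
    obtain ⟨⟨b, i'⟩, -, hφ⟩ := List.mem_flatMap.1 hφ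
    simp only [List.mem_cons, List.mem_nil_iff, or_false] at hφ
    rcases hφ with rfl | rfl <;> exact ⟨fun j u c h => mkAddr_wf M hh hval (cc _) (ccJ _) _ u c h⟩
  · unfold nFams at hφ
    simp only [List.mem_append, List.mem_cons, List.mem_nil_iff, or_false, List.mem_flatMap, List.mem_map, List.mem_range] at hφ
    rcases hφ with (((((rfl | rfl | rfl | rfl | rfl | rfl) | ⟨j, -, rfl | rfl⟩) | ⟨a, -, r, -, rfl⟩) | ⟨hd', -, nb, -, rfl⟩) | ⟨r, -, rfl⟩) | ⟨v, -, v', -, hφ⟩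
    · exact ⟨fun j u c h => mkAddr_wf M hh hval (cc _) (ccJ _) _ u c h⟩
    · exact ⟨fun j u c h => mkAddr_wf M hh hval (cc _) (ccJ _) _ u c h⟩
    · exact ⟨fun j u c h => mkAddr_wf M hh hval (cc _) (ccJ _) _ u c h⟩
    · exact ⟨fun j u c h => mkAddr_wf M hh hval (cc _) (vvJ _) _ u c h⟩
    · exact ⟨fun j u c h => mkAddr_wf M hh hval (cc _) (ccJ _) _ u c h⟩
    · exact ⟨fun j u c h => mkAddr_wf M hh hval (vv _) (vvJ _) _ u c h⟩
    · exact ⟨fun j u c h => mkAddr_wf M hh hval (cc _) (ccJ _) _ u c h⟩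
    · exact ⟨fun j u c h => mkAddr_wf M hh hval (cc _) (ccJ _) _ u c h⟩
    · refine ⟨fun j u c h => ?_⟩
      induction j using Fin.lastCases with
      | last => simp only [topFam, Fin.lastCases_last] at h; exact mkAddr_wf M hh hval (vv _) (ccJ _) _ u c h
      | cast s => simp only [topFam, Fin.lastCases_castSucc] at h; exact mkAddr_wf M hh hval (vv _) (ccJ _) _ u c h
    · refine ⟨fun j u c h => ?_⟩
      induction j using Fin.lastCases with
      | last => simp only [intFam, Fin.lastCases_last] at h; exact mkAddr_wf M hh hval (vv _) (vvJ _) _ u c h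
      | cast s =>
        simp only [intFam, Fin.lastCases_castSucc] at h
        induction s using Fin.addCases with
        | left s => simp only [Fin.addCases_left] at h; exact mkAddr_wf M hh hval (vv _) (ccJ _) _ u c h
        | right s => simp only [Fin.addCases_right] at h; exact mkAddr_wf M hh hval (vv _) (vvJ _) _ u c h
    · exact ⟨fun j u c h => mkAddr_wf M hh hval (vv _) (ccJ _) _ u c h⟩
    · by_cases hvv : v = v'
      · rw [if_pos hvv] at hφ; simp at hφ
      · rw [if_neg hvv] at hφ
        simp only [List.mem_singleton] at hφ
        subst hφ
        exact ⟨fun j u c h => mkAddr_wf M hh hval (vv _) (vvJ _) _ u c h⟩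

include hh hval in
/-- **The arithmetized tableau is well formed** on the node set. [folklore] -/
theorem wf_tableauCSP : (tableauCSP M L P T x).WF (nodes (F := F) L.h) :=
  ⟨fun i => wf_of_mem M hh hval ((mem_fams_iff M L P T x _).1 ⟨i, rfl⟩)⟩

end WF

/-! ### Degree bound -/

section Degree

variable {x : List Bool} {P T : ℕ}

local notation "d" => dM M
local notation "n" => x.length

omit [DecidableEq F] in
/-- A clause polynomial has degree at most its number of reads. [folklore] -/
theorem totalDegree_clausePoly_le {Kk r : ℕ} (prem concl : List (Fin r)) :
    (clausePoly (F := F) (K := Kk) prem concl).totalDegree ≤ prem.length + concl.length := by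
  unfold clausePoly
  refine (MvPolynomial.totalDegree_mul _ _).trans (Nat.add_le_add ?_ ?_)
  · refine (MvPolynomial.totalDegree_list_prod _).trans ?_
    rw [List.map_map]
    refine (List.sum_le_card_nsmul _ 1 fun a ha => ?_).trans (by simp)
    obtain ⟨j, -, rfl⟩ := List.mem_map.1 ha
    simp only [Function.comp_apply, rd]
    exact (MvPolynomial.totalDegree_X _).le
  · refine (MvPolynomial.totalDegree_list_prod _).trans ?_
    rw [List.map_map]
    refine (List.sum_le_card_nsmul _ 1 fun a ha => ?_).trans (by simp)
    obtain ⟨j, -, rfl⟩ := List.mem_map.1 ha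
    simp only [Function.comp_apply]
    refine (MvPolynomial.totalDegree_sub _ _).trans (max_le (by simp) ?_)
    simp only [rd]
    exact (MvPolynomial.totalDegree_X _).le

/-- Degree of the step guard. [folklore] -/
theorem totalDegree_stepGuard_le {r : ℕ} : (stepGuard (F := F) (r := r) M L T).totalDegree ≤ 3 * L.kt * (L.h - 1) := by
  unfold stepGuard
  refine (MvPolynomial.totalDegree_mul _ _).trans ?_
  have h1 := totalDegree_LTC_le (F := F) L.h L.kt T (Ut (r := r) M L)
  have h2 := totalDegree_SUCC_le (F := F) L.h L.kt (Ut (r := r) M L) (Ut' M L)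
  calc _ ≤ L.kt * (L.h - 1) + 2 * L.kt * (L.h - 1) := Nat.add_le_add h1 h2
    _ = 3 * L.kt * (L.h - 1) := by ring

/-- Degree of the cell guard. [folklore] -/
theorem totalDegree_cellGuard_le {r : ℕ} : (cellGuard (F := F) (r := r) M L n P T).totalDegree ≤ (L.kt + L.kJ) * (L.h - 1) := by
  unfold cellGuard
  refine (MvPolynomial.totalDegree_mul _ _).trans ?_
  have h1 := totalDegree_LTC_le (F := F) L.h L.kt (T + 1) (Ut (r := r) M L)
  have h2 := totalDegree_LTC_le (F := F) L.h L.kJ (S1 M n P T + 1) (Uc (r := r) M L ⟨0, by omega⟩)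
  calc _ ≤ L.kt * (L.h - 1) + L.kJ * (L.h - 1) := Nat.add_le_add h1 h2
    _ = (L.kt + L.kJ) * (L.h - 1) := by ring

/-- Degree of the interior guard. [folklore] -/
theorem totalDegree_intGuard_le {r : ℕ} :
    (intGuard (F := F) (r := r) M L n P T).totalDegree ≤ (3 * L.kt + (4 * d + 2) * L.kJ) * (L.h - 1) := by
  unfold intGuard
  have h1 : (stepGuard (F := F) (r := r) M L T).totalDegree ≤ 3 * L.kt * (L.h - 1) := totalDegree_stepGuard_le M
  have h2 : (((List.finRange (2 * d)).map fun i : Fin (2 * d) =>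
      SUCC L.h L.kJ (Uc (r := r) M L (Fin.castSucc i)) (Uc M L i.succ)).prod : MvPolynomial _ F).totalDegree ≤
      2 * d * (2 * L.kJ * (L.h - 1)) := by
    refine (MvPolynomial.totalDegree_list_prod _).trans ?_
    rw [List.map_map]
    refine (List.sum_le_card_nsmul _ (2 * L.kJ * (L.h - 1)) fun a ha => ?_).trans (by simp)
    obtain ⟨i, -, rfl⟩ := List.mem_map.1 ha
    exact totalDegree_SUCC_le (F := F) L.h L.kJ _ _
  have h3 : (1 - LTC L.h L.kJ (d + 1) (Uc (r := r) M L ⟨0, by omega⟩) : MvPolynomial _ F).totalDegree ≤ L.kJ * (L.h - 1) :=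
    (MvPolynomial.totalDegree_sub _ _).trans (max_le (by simp) (totalDegree_LTC_le (F := F) L.h L.kJ _ _))
  have h4 := totalDegree_LTC_le (F := F) L.h L.kJ (d + 1 + NN n P + d * T) (Uc (r := r) M L ⟨0, by omega⟩)
  calc _ ≤ ((3 * L.kt * (L.h - 1) + 2 * d * (2 * L.kJ * (L.h - 1))) + L.kJ * (L.h - 1)) + L.kJ * (L.h - 1) :=
        (MvPolynomial.totalDegree_mul _ _).trans (Nat.add_le_add ((MvPolynomial.totalDegree_mul _ _).trans
          (Nat.add_le_add ((MvPolynomial.totalDegree_mul _ _).trans (Nat.add_le_add h1 h2)) h3)) h4)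
    _ = (3 * L.kt + (4 * d + 2) * L.kJ) * (L.h - 1) := by ring

/-- **The degree bound of the arithmetized tableau.** [folklore] -/
def degBound (M : TM2ComputableAux Bool Bool) (L : Layout) : ℕ :=
  (3 * L.kt + (4 * dM M + 2) * L.kJ) * (L.h - 1) + (3 * dM M + 3) + Nat.card (Val M.tm)

/-- Every family of the list has degree at most `degBound`. [folklore] -/
theorem totalDegree_le_of_mem {φ : Family F (KIdx L d) (mPt L)} (hφ : φ ∈ xFams M L x ++ nFams M L n P T) :
    φ.poly.totalDegree ≤ degBound M L := by
  have hB : degBound M L = (3 * L.kt + (4 * d + 2) * L.kJ) * (L.h - 1) + (3 * d + 3) + Nat.card (Val M.tm) := rfl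
  have hJ2 : 2 * L.kJ ≤ (4 * d + 2) * L.kJ := Nat.mul_le_mul_right _ (by omega)
  have hkt : 3 * L.kt * (L.h - 1) ≤ (3 * L.kt + (4 * d + 2) * L.kJ) * (L.h - 1) := Nat.mul_le_mul_right _ (by omega)
  have hkk : (L.kt + L.kJ) * (L.h - 1) ≤ (3 * L.kt + (4 * d + 2) * L.kJ) * (L.h - 1) := Nat.mul_le_mul_right _ (by omega)
  have hkJ : 2 * L.kJ * (L.h - 1) ≤ (3 * L.kt + (4 * d + 2) * L.kJ) * (L.h - 1) := Nat.mul_le_mul_right _ (by omega)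
  -- the shapes
  have unit : ∀ (t0 J0 : ℕ) (v : Val M.tm), (unitFam (F := F) M L t0 J0 v).poly.totalDegree ≤ degBound M L := by
    intro t0 J0 v
    show (1 * clausePoly (F := F) (K := KIdx L d) ([] : List (Fin 1)) [0]).totalDegree ≤ _
    rw [one_mul]
    exact (totalDegree_clausePoly_le _ _).trans (by rw [hB]; simp only [List.length_nil, List.length_cons]; omega)
  rcases List.mem_append.1 hφ with hφ | hφ
  · unfold xFams at hφ
    obtain ⟨⟨b, i'⟩, -, hφ⟩ := List.mem_flatMap.1 hφ
    simp only [List.mem_cons, List.mem_nil_iff, or_false] at hφ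
    rcases hφ with rfl | rfl <;> exact unit _ _ _
  · unfold nFams at hφ
    simp only [List.mem_append, List.mem_cons, List.mem_nil_iff, or_false, List.mem_flatMap, List.mem_map, List.mem_range] at hφ
    rcases hφ with (((((rfl | rfl | rfl | rfl | rfl | rfl) | ⟨j, -, rfl | rfl⟩) | ⟨a, -, r, -, rfl⟩) | ⟨hd', -, nb, -, rfl⟩) | ⟨r, -, rfl⟩) | ⟨v, -, v', -, hφ⟩
    · exact unit _ _ _
    · exact unit _ _ _
    · exact unit _ _ _
    · show ((1 - LTC L.h L.kJ (NN n P + 1) (Uc M L ⟨0, _⟩)) * LTC L.h L.kJ (S1 M n P T + 1) (Uc M L ⟨0, _⟩) *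
          clausePoly (F := F) (K := KIdx L d) ([] : List (Fin 1)) [0]).totalDegree ≤ _
      refine (MvPolynomial.totalDegree_mul _ _).trans ?_
      have h1 : ((1 - LTC L.h L.kJ (NN n P + 1) (Uc (r := 1) M L ⟨0, by omega⟩)) * LTC L.h L.kJ (S1 M n P T + 1) (Uc M L ⟨0, by omega⟩) :
          MvPolynomial _ F).totalDegree ≤ 2 * L.kJ * (L.h - 1) := by
        refine (MvPolynomial.totalDegree_mul _ _).trans ?_
        have ha : (1 - LTC L.h L.kJ (NN n P + 1) (Uc (r := 1) M L ⟨0, by omega⟩) : MvPolynomial _ F).totalDegree ≤ L.kJ * (L.h - 1) :=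
          (MvPolynomial.totalDegree_sub _ _).trans (max_le (by simp) (totalDegree_LTC_le (F := F) L.h L.kJ _ _))
        have hb := totalDegree_LTC_le (F := F) L.h L.kJ (S1 M n P T + 1) (Uc (r := 1) M L ⟨0, by omega⟩)
        calc _ ≤ L.kJ * (L.h - 1) + L.kJ * (L.h - 1) := Nat.add_le_add ha hb
          _ = 2 * L.kJ * (L.h - 1) := by ring
      have h2 := totalDegree_clausePoly_le (F := F) (Kk := KIdx L d) ([] : List (Fin 1)) [0]
      simp only [List.length_nil, List.length_cons, zero_add] at h2
      rw [hB]; omega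
    · exact unit _ _ _
    · show (cellGuard M L n P T * clausePoly (F := F) (K := KIdx L d) ([] : List (Fin (Nat.card (Val M.tm)))) (List.finRange _)).totalDegree ≤ _
      refine (MvPolynomial.totalDegree_mul _ _).trans ?_
      have h1 : (cellGuard (F := F) (r := Nat.card (Val M.tm)) M L n P T).totalDegree ≤ (L.kt + L.kJ) * (L.h - 1) :=
        totalDegree_cellGuard_le M
      have h2 := totalDegree_clausePoly_le (F := F) (Kk := KIdx L d) ([] : List (Fin (Nat.card (Val M.tm)))) (List.finRange _)
      simp only [List.length_nil, List.length_finRange, zero_add] at h2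
      rw [hB]; omega
    · show (1 * clausePoly (F := F) (K := KIdx L d) ([] : List (Fin 3)) [0, 1, 2]).totalDegree ≤ _
      rw [one_mul]
      exact (totalDegree_clausePoly_le _ _).trans (by rw [hB]; simp only [List.length_nil, List.length_cons]; omega)
    · show (1 * clausePoly (F := F) (K := KIdx L d) ([0] : List (Fin 2)) [1]).totalDegree ≤ _
      rw [one_mul]
      exact (totalDegree_clausePoly_le _ _).trans (by rw [hB]; simp only [List.length_nil, List.length_cons]; omega)
    · show (stepGuard M L T * clausePoly (F := F) (K := KIdx L d) ((List.finRange (3 * d + 1)).map Fin.castSucc) [Fin.last (3 * d + 1)]).totalDegree ≤ _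
      refine (MvPolynomial.totalDegree_mul _ _).trans ?_
      have h1 : (stepGuard (F := F) (r := 3 * d + 2) M L T).totalDegree ≤ 3 * L.kt * (L.h - 1) := totalDegree_stepGuard_le M
      have h2 := totalDegree_clausePoly_le (F := F) (Kk := KIdx L d) ((List.finRange (3 * d + 1)).map Fin.castSucc) [Fin.last (3 * d + 1)]
      simp only [List.length_map, List.length_finRange, List.length_cons, List.length_nil] at h2
      rw [hB]; omega
    · show (intGuard M L n P T * clausePoly (F := F) (K := KIdx L d)
          (((List.finRange (d + 1)).map fun s => Fin.castSucc (Fin.castAdd (2 * d + 1) s)) ++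
            ((List.finRange (2 * d + 1)).map fun s => Fin.castSucc (Fin.natAdd (d + 1) s))) [Fin.last ((d + 1) + (2 * d + 1))]).totalDegree ≤ _
      refine (MvPolynomial.totalDegree_mul _ _).trans ?_
      have h1 : (intGuard (F := F) (r := (d + 1) + (2 * d + 1) + 1) M L n P T).totalDegree ≤
          (3 * L.kt + (4 * d + 2) * L.kJ) * (L.h - 1) := totalDegree_intGuard_le M
      have h2 := totalDegree_clausePoly_le (F := F) (Kk := KIdx L d)
        (((List.finRange (d + 1)).map fun s => Fin.castSucc (Fin.castAdd (2 * d + 1) s)) ++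
          ((List.finRange (2 * d + 1)).map fun s => Fin.castSucc (Fin.natAdd (d + 1) s))) [Fin.last ((d + 1) + (2 * d + 1))]
      simp only [List.length_append, List.length_map, List.length_finRange, List.length_cons, List.length_nil] at h2
      rw [hB]; omega
    · show (stepGuard M L T * clausePoly (F := F) (K := KIdx L d) ([] : List (Fin 1)) [0]).totalDegree ≤ _
      refine (MvPolynomial.totalDegree_mul _ _).trans ?_
      have h1 : (stepGuard (F := F) (r := 1) M L T).totalDegree ≤ 3 * L.kt * (L.h - 1) := totalDegree_stepGuard_le M
      have h2 := totalDegree_clausePoly_le (F := F) (Kk := KIdx L d) ([] : List (Fin 1)) [0]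
      simp only [List.length_nil, List.length_cons, zero_add] at h2
      rw [hB]; omega
    · by_cases hvv : v = v'
      · rw [if_pos hvv] at hφ; simp at hφ
      · rw [if_neg hvv] at hφ
        simp only [List.mem_singleton] at hφ
        subst hφ
        show (cellGuard M L n P T * clausePoly (F := F) (K := KIdx L d) ([0, 1] : List (Fin 2)) []).totalDegree ≤ _
        refine (MvPolynomial.totalDegree_mul _ _).trans ?_
        have h1 : (cellGuard (F := F) (r := 2) M L n P T).totalDegree ≤ (L.kt + L.kJ) * (L.h - 1) := totalDegree_cellGuard_le M
        have h2 := totalDegree_clausePoly_le (F := F) (Kk := KIdx L d) ([0, 1] : List (Fin 2)) []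
        simp only [List.length_nil, List.length_cons, add_zero] at h2
        rw [hB]; omega

/-- **The arithmetized tableau has degree at most `degBound`.** [folklore] -/
theorem maxDeg_tableauCSP_le : (tableauCSP (F := F) M L P T x).maxDeg ≤ degBound M L :=
  Finset.sup_le fun i _ => totalDegree_le_of_mem M ((mem_fams_iff M L P T x _).1 ⟨i, rfl⟩)

end Degree

/-! ### Counting the reads -/

section Count

variable {x : List Bool} {P T : ℕ}

omit [Field F] [DecidableEq F] in
/-- Mapping over an optional singleton. [folklore] -/
theorem map_ite_nil_singleton {α β : Type} (f : α → β) (c : Prop) [Decidable c] (a : α) :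
    List.map f (if c then [] else [a]) = if c then [] else [f a] := by
  split_ifs <;> rfl

/-- **The arities of the `n`-families depend on the machine and on `P` only** (not on the field,
the layout, `n` or `T`). [folklore] -/
theorem sum_arity_nFams_eq {F' : Type} [Field F'] [DecidableEq F'] (L L' : Layout) (n n' T T' : ℕ) :
    ((nFams (F := F) M L n P T).map Family.arity).sum = ((nFams (F := F') M L' n' P T').map Family.arity).sum := by
  classical
  unfold nFams
  simp only [List.map_append, List.map_cons, List.map_nil, List.sum_append, List.sum_cons, List.sum_nil, List.map_flatMap,
    List.map_map, Function.comp_def, map_ite_nil_singleton, unitFam, tailFam, cellAnyFam, certAnyFam, certNextFam, topFam,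
    intFam, botFam, cellPairFam]

omit [Field F] [DecidableEq F] in
/-- Length of an optional singleton. [folklore] -/
theorem length_ite_nil_singleton {α : Type} (c : Prop) [Decidable c] (a : α) :
    (if c then ([] : List α) else [a]).length = if c then 0 else 1 := by
  split_ifs <;> rfl

/-- **The number of `n`-families depends on the machine, `P` and `d` only.** [folklore] -/
theorem length_nFams_eq {F' : Type} [Field F'] [DecidableEq F'] (L L' : Layout) (n n' T T' : ℕ) :
    (nFams (F := F) M L n P T).length = (nFams (F := F') M L' n' P T').length := by
  classical
  unfold nFams
  simp only [List.length_append, List.length_cons, List.length_nil, List.length_flatMap, List.length_map,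
    length_ite_nil_singleton, List.length_range, List.length_finRange]

/-- **The number of reads of the `n`-families**, a constant of the machine (for `P = 0`). [folklore] -/
def cQ (M : TM2ComputableAux Bool Bool) : ℕ := ((nFams (F := ℚ) M ⟨2, 1, 1⟩ 0 0 0).map Family.arity).sum

/-- The arity sum of the `n`-families without certificate is `cQ`. [folklore] -/
theorem sum_arity_nFams_zero (L : Layout) (n T : ℕ) : ((nFams (F := F) M L n 0 T).map Family.arity).sum = cQ M :=
  sum_arity_nFams_eq M L _ n _ T _

/-- `|Val| ≤ cQ` (the block family reads all values). [folklore] -/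
theorem card_val_le_cQ : Nat.card (Val M.tm) ≤ cQ M := by
  unfold cQ nFams
  simp only [List.map_append, List.map_cons, List.sum_append, List.sum_cons]
  have : (cellAnyFam (F := ℚ) M ⟨2, 1, 1⟩ 0 0 0).arity = Nat.card (Val M.tm) := rfl
  omega

-- `cQ` and `degBound` are symbolic constants of the machine (sums over enumerations of its block
-- values, `Nat.card`); definitional unfolding (`whnf`) must not try to evaluate them.
attribute [irreducible] cQ degBound

end Count

end TableauCSP

end Literature.Computability.Complexity

end
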